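import Literature.NumberTheory.Rogawski1990.RankOneUnstableWildTorusWrapperCore   -- ★-to-be p844383 (B-p12 (g30)): `depth_and_sign_of_descent_frame` + fold packaging (brings ★ p844311, ★ p844273, ★ p844075)
import Literature.NumberTheory.Rogawski1990.RankOneUnstableWildBookkeeping          -- ★ p844144 (B-p12 (g30)): `valued_lt_of_toNat_succ_le` (depth ⇒ smallness); brings the torus pack
import Literature.NumberTheory.Rogawski1990.RankOneKappaOrbitalShellDressTorus        -- ★ p844241 (A-p13 (g32)): `forall_exists_descent_eq_smul_regRep_of_pos` (descent along `Z(t₀)`)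
import Literature.NumberTheory.Rogawski1990.RankOneTorusEigenframeTransfer          -- ★ p843963 (A-p19 (g23)): brings ★ `coe_localNonsplitEquiv_mul_map_eq` (the `E₂`-frame read at `w`)
import HarnessLib

/-!
# [LabesseLanglands1979 §2 (2.1)–(2.2); Labesse2024 Prop. 0.0.11, Th. 0.0.12] road «W′» = «R1LL-WILD», sub-socket (B6-O) FILE B — THE TORUS WRAPPER:
# the fold's `(k₀ c₀ hoT hκT)` ∕ `hnn` along `Z(t₀)` from the window coordinate `βF` and the difference coordinate `bc`

Topic `NumberTheory/Rogawski1990`; namespace `Literature.NumberTheory.Rogawski1990`.  THEOREMS ONLY (no definition, no instance, no notation, no named fact, no `sorry`).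
Cell `pub/hodgecm-mathlib` (D-0151), crux H413 = `stmt-HodgeConjecture-24833`, line «N6nsGerm», wild residue `stub_N6nsR1ramWild`; (W′-B6) heir of F0P3-p01 (g14): v3 stub
07fb81b8 recipe line «`obtain ⟨k₁, c₀, hoT, hκT, hnn⟩ := ‹(B6-O) FILE B› … hbc hspec …`» for ★ fold ED. 2 p844308 `exists_wildLaw_torus_of_shellLaws_of_le` and ★ p844316
`exists_wildLaw_of_fold`; FILE B = B-p12 (g30) (orphan of A-p03 (g26), census `F0/P3a/B-p12/g30/CENSUS-B6O-FILEB-TorusWrapper.B-p12g30.md` 7c6143ee).  HONEST LABEL: HC_CM is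
proved only modulo the printed citations (hLiu418, h413) until rung 0 closes; this file is bookkeeping over ★ lemmas and asserts nothing printed.

THE MATHEMATICS.  Along the framed elliptic torus `Z(t₀) ⊂ H_v` at a RAMIFIED non-split `w ∣ v` in STANDARD POSITION (`hpos`: the `E₂`-descent of `t₀` is a non-scalar
`s₀ • ι(a₀ + b₀ M_τ)`, hence so is every `t`'s, ★ A-p13 `forall_exists_descent_eq_smul_regRep_of_pos`), the `E₂`-matrix `X_t` of `t` is framed at `w` by `Q := P_w`
(★ `coe_localNonsplitEquiv_mul_map_eq`) with eigenvalues `xᵢ t = ((P⁻¹ t P)ᵢᵢ)_w` — the SAME `xᵢ` the difference coordinate `bc t` reads (`ι bc t = (x₀∕x₁ − x₁∕x₀)∕η`).  The frame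
column `(diag(1,α)·Q)·,₀` lies on ONE of the two `t`-free eigenlines `(−σ_w τE : 1)`, `(−τE : 1)` (§1 `frame_column_cases`, ★ `eigenvec_dichotomy_of_regRep_map`), deciding the
LABEL CASE once for the whole torus; in either case ★ FILE B-core `depth_and_sign_of_descent_frame` (at `τE`, resp. `σ_w τE`) gives, for (B6-V)'s window coordinate `βF t`
(`ι βF = α·X₁₀∕X₀₀`, `|βF|_v = exp(−oT t)`), the DEPTH `|ι bc t| = exp(−(2·oT t + 2k₁))`, `k₁ := −log|2c′|_v` (`ι c′ = (τE − σ_w τE)∕η`), the SIGN `(bc t·c₀, θ)_v = (βF t, θ)_v`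
with `c₀ := ±2c′`, and `0 ≤ oT t + k₁` — on the deep regular locus `N t ≥ M` (deepness read off `N t` by ★ `valued_lt_of_toNat_succ_le`).
* §1 `frame_column_cases`, `descent_scalars_ne_zero` (the frame column is an eigenvector; `b ≠ 0`, `s ≠ 0` for a regular `t`).
* §2 HEAD `exists_depth_sign_dictionary_torus` (the (B6-O) FILE B deliverable: `∃ M k₁ c₀`, `hoT ∧ hsign ∧ hnn` with the sign in `βF`-currency), and
  `exists_depth_sign_dictionary_torus_of_norm` (the same with (B6-V)'s `κT t = (βF·n_t, θ)_v`, `(n_t, θ)_v = 1`, folded in: `hκT` literally).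

## References
* [LabesseLanglands1979] J.-P. Labesse, R. P. Langlands, *L-indistinguishability for SL(2)*, Canad. J. Math. 31 (1979): §2 (2.1)–(2.2) pp. 8–9.
* [Labesse2024StabilisationGermesSL2] J.-P. Labesse, *Stabilisation des germes de SL(2)* (arXiv:2411.14820, 2024): Prop. 0.0.10–0.0.11, Th. 0.0.12 pp. 7–8.
* [Rogawski1990] J. D. Rogawski, *Automorphic Representations of Unitary Groups in Three Variables*, Ann. of Math. Stud. 123 (1990): §3.6 pp. 31–32, §4.9 Lemma 4.9.3 p. 56.
* [Omeara1963] O. T. O'Meara, *Introduction to Quadratic Forms* (1963): §63B.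
-/

set_option autoImplicit false

noncomputable section

open NumberField IsDedekindDomain Matrix ValuativeRel
open scoped Matrix MatrixGroups

namespace Literature.NumberTheory.Rogawski1990

open Literature.NumberTheory.Automorphic Literature.NumberTheory.Automorphic.UnitaryGroup Literature.NumberTheory.GaloisRepresentations
open Literature.NumberTheory.QuadraticForms Literature.NumberTheory.NumberFields

/-! ## §1 The frame column is an eigenvector: the `t`-free label dichotomy; non-degeneracy of the descent at a regular element -/

section Column

variable {F E : Type*} [Field F] [Field E] (ι : F →+* E) {u₀ v₀ : F} {τ τ' : E}

/-- **NON-DEGENERACY OF THE DESCENT AT A REGULAR ELEMENT**: if `X·Q = Q·diag(x₀,x₁)` with `det Q` a unit, `x₀ ≠ x₁`, `x₁ ≠ 0`, and `D·X·D′ = s • ι(a + b M_τ)` with `D′D = 1`,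
then `s ≠ 0` and `b ≠ 0` (else `X` is scalar). [cite: LabesseLanglands1979, §2 (2.1)] [cite: Rogawski1990, §3.6 pp. 31–32] -/
theorem descent_scalars_ne_zero {a b : F} {s x₀ x₁ : E} {X Q D D' : Matrix (Fin 2) (Fin 2) E} (hX : X * Q = Q * Matrix.diagonal ![x₀, x₁]) (hDD : D' * D = 1)
    (hG : D * X * D' = s • (!![a, b * v₀; b, a + b * u₀]).map ι) (hQ : IsUnit Q.det) (hne : x₀ ≠ x₁) (hx₁ : x₁ ≠ 0) : s ≠ 0 ∧ b ≠ 0 := by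
  have hQQ : Q⁻¹ * Q = 1 := Matrix.nonsing_inv_mul Q hQ
  -- `X = D′ (s • ι M) D` and `diag(x₀, x₁) = Q⁻¹ X Q`
  have hXeq : X = D' * (s • (!![a, b * v₀; b, a + b * u₀]).map ι) * D := by
    rw [← hG, ← Matrix.mul_assoc, ← Matrix.mul_assoc, hDD, Matrix.one_mul, Matrix.mul_assoc, hDD, Matrix.mul_one]
  have hkey : Matrix.diagonal ![x₀, x₁] = Q⁻¹ * X * Q := by
    rw [Matrix.mul_assoc, hX, ← Matrix.mul_assoc, hQQ, Matrix.one_mul]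
  -- if `X = c • 1` then `diag(x₀, x₁) = c • 1`
  have hscalar : ∀ c : E, X = c • (1 : Matrix (Fin 2) (Fin 2) E) → False := by
    intro c hc
    have h : Matrix.diagonal ![x₀, x₁] = c • (1 : Matrix (Fin 2) (Fin 2) E) := by
      rw [hkey, hc, Matrix.mul_smul, Matrix.mul_one, Matrix.smul_mul, hQQ]
    have h00 := congr_fun (congr_fun h 0) 0
    have h11 := congr_fun (congr_fun h 1) 1
    simp at h00 h11
    exact hne (h00.trans h11.symm)
  refine ⟨fun hs => ?_, fun hb => ?_⟩
  · refine hx₁ ?_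
    have h0 : X = 0 := by rw [hXeq, hs, zero_smul, Matrix.mul_zero, Matrix.zero_mul]
    have hQd : Matrix.diagonal ![x₀, x₁] = 0 := by rw [hkey, h0, Matrix.mul_zero, Matrix.zero_mul]
    have h11 := congr_fun (congr_fun hQd 1) 1
    simpa using h11
  · exact hscalar (s * ι a) (by
      rw [hXeq, hb]
      have hM : (!![a, (0 : F) * v₀; 0, a + 0 * u₀]).map ι = ι a • (1 : Matrix (Fin 2) (Fin 2) E) := by
        ext i j; fin_cases i <;> fin_cases j <;> simp
      rw [hM, smul_smul, Matrix.mul_smul, Matrix.smul_mul, Matrix.mul_one, hDD])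

/-- **THE FRAME COLUMN IS AN EIGENVECTOR, HENCE ON ONE OF THE TWO `t`-FREE EIGENLINES**: with `τ + τ′ = ι u₀`, `ττ′ = −ι v₀`, `X·Q = Q·diag(x₀,x₁)`, `det Q`, `det D` units,
`D′D = 1`, `D·X·D′ = s • ι(a + b M_τ)`, `s ≠ 0`, `b ≠ 0`: `(D Q)₁₀ ≠ 0` and `(D Q)₀₀ = −τ′·(D Q)₁₀ ∨ (D Q)₀₀ = −τ·(D Q)₁₀` (★ `eigenvec_dichotomy_of_regRep_map`).
[cite: LabesseLanglands1979, §2 (2.1)] [cite: Labesse2024StabilisationGermesSL2, Prop. 0.0.10] -/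
theorem frame_column_cases (hsum : τ + τ' = ι u₀) (hprod : τ * τ' = -ι v₀) {a b : F} {s x₀ x₁ : E} {X Q D D' : Matrix (Fin 2) (Fin 2) E}
    (hX : X * Q = Q * Matrix.diagonal ![x₀, x₁]) (hDD : D' * D = 1)
    (hG : D * X * D' = s • (!![a, b * v₀; b, a + b * u₀]).map ι) (hQ : IsUnit Q.det) (hD : IsUnit D.det) (hs : s ≠ 0) (hb : b ≠ 0) :
    (D * Q) 1 0 ≠ 0 ∧ ((D * Q) 0 0 = -τ' * (D * Q) 1 0 ∨ (D * Q) 0 0 = -τ * (D * Q) 1 0) := by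
  -- `(s • ι M) · (D Q) = (D Q) · diag`
  have hV : (s • (!![a, b * v₀; b, a + b * u₀]).map ι) * (D * Q) = (D * Q) * Matrix.diagonal ![x₀, x₁] := by
    rw [← hG, Matrix.mul_assoc, Matrix.mul_assoc, ← Matrix.mul_assoc D' D Q, hDD, Matrix.one_mul, hX, Matrix.mul_assoc]
  -- column `0` is an eigenvector for `x₀`
  have hcol0 : (s • (!![a, b * v₀; b, a + b * u₀]).map ι) *ᵥ (fun i => (D * Q) i 0) = x₀ • fun i => (D * Q) i 0 := by
    ext i
    have h := congr_fun (congr_fun hV i) 0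
    rw [Matrix.mul_apply] at h
    simp only [Matrix.mulVec, dotProduct, Pi.smul_apply, smul_eq_mul]
    rw [h, Matrix.mul_apply, Fin.sum_univ_two, Matrix.diagonal_apply_eq, Matrix.diagonal_apply_ne _ (by decide : (1 : Fin 2) ≠ 0)]
    simp
    ring
  have hvec : (fun i => (D * Q) i 0) = ![(D * Q) 0 0, (D * Q) 1 0] := by
    ext i; fin_cases i <;> rfl
  have hcol0' : ((!![a, b * v₀; b, a + b * u₀]).map ι) *ᵥ ![(D * Q) 0 0, (D * Q) 1 0] = (s⁻¹ * x₀) • ![(D * Q) 0 0, (D * Q) 1 0] := by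
    rw [hvec, Matrix.smul_mulVec] at hcol0
    have h := congrArg (fun z => s⁻¹ • z) hcol0
    simp only [smul_smul, inv_mul_cancel₀ hs, one_smul] at h
    exact h
  -- the column is non-zero (`D Q` is invertible)
  have hDQ : IsUnit (D * Q).det := by rw [Matrix.det_mul]; exact hD.mul hQ
  have hpq : ((D * Q) 0 0, (D * Q) 1 0) ≠ (0, 0) := by
    intro h0
    simp only [Prod.mk.injEq] at h0
    have hdet : (D * Q).det = 0 := by
      rw [Matrix.det_fin_two, h0.1, h0.2]; ring
    exact hDQ.ne_zero hdet
  exact eigenvec_dichotomy_of_regRep_map ι hsum hprod hb hpq hcol0'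

end Column

/-! ## §2 Along the torus: the (B6-O) FILE B deliverable -/

section Torus

variable (L : Type) [Field L] [NumberField L] [IsCMField L] (v : HeightOneSpectrum (𝓞 ↥(maximalRealSubfield L)))
  (w : PlacesOver L v) (hw : IsCMField.complexConj L • w.1 = w.1) (he : v.asIdeal.ramificationIdx' w.1.asIdeal ≠ 1)
  (t₀ : ((cmDatum L 2 (Matrix.of fun i j : Fin 2 => if i.val + j.val + 1 = 2 then (1 : L) else 0)).Local v × (cmDatum L 1 (Matrix.of fun i j : Fin 1 => if i.val + j.val + 1 = 1 then (1 : L) else 0)).Local v)) (P : GL (Fin 2) (LocalRing L v)) (d : Fin 2 → LocalRing L v)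
  (ht₀ : IsRegularElt (t₀.1.val : GL (Fin 2) (LocalRing L v)))
  (hP : (t₀.1.val.val : Matrix (Fin 2) (Fin 2) (LocalRing L v)) * P.val = P.val * Matrix.diagonal d) (hd1 : ∀ i, conjLocal L (IsCMField.complexConj L) v (d i) * d i = 1)
  (E₂ : (cmDatum L 2 (Matrix.of fun i j : Fin 2 => if i.val + j.val + 1 = 2 then (1 : L) else 0)).Local v ≃ₜ* ↥(unitaryGroupOfForm (galAdicCompletionMap (L := L) (IsCMField.complexConj L) hw) (placeForm (Matrix.of fun i j : Fin 2 => if i.val + j.val + 1 = 2 then (1 : L) else 0) w.1)))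
  (hE₂ : ∀ g, ((E₂ g : ↥(unitaryGroupOfForm (galAdicCompletionMap (L := L) (IsCMField.complexConj L) hw) (placeForm (Matrix.of fun i j : Fin 2 => if i.val + j.val + 1 = 2 then (1 : L) else 0) w.1))) : GL (Fin 2) (w.1.adicCompletion L)) = ((localNonsplitEquiv (IsCMField.complexConj L) (Matrix.of fun i j : Fin 2 => if i.val + j.val + 1 = 2 then (1 : L) else 0) (IsCMField.complexConj_ne_one L) w hw g : ↥(unitaryGroupOfForm (galAdicCompletionMap (L := L) (IsCMField.complexConj L) hw) (placeForm (Matrix.of fun i j : Fin 2 => if i.val + j.val + 1 = 2 then (1 : L) else 0) w.1))) : GL (Fin 2) (w.1.adicCompletion L)))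
  {α : (w.1.adicCompletion L)} (hα : (galAdicCompletionMap (L := L) (IsCMField.complexConj L) hw) α = -α) (hα0 : α ≠ 0)
  {u₀ v₀ : (v.adicCompletion ↥(maximalRealSubfield L))} (hv0 : v₀ ≠ 0) {τE : (w.1.adicCompletion L)} (hτ : τE * τE = toPlace v w u₀ * τE + toPlace v w v₀) (hστ : (galAdicCompletionMap (L := L) (IsCMField.complexConj L) hw) τE = toPlace v w u₀ - τE)
  (hτne : τE ≠ (galAdicCompletionMap (L := L) (IsCMField.complexConj L) hw) τE)
  {η : (w.1.adicCompletion L)} (hση : (galAdicCompletionMap (L := L) (IsCMField.complexConj L) hw) η = -η) (hη0 : η ≠ 0)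
  (hpos : ∃ (s : (w.1.adicCompletion L)) (a b : (v.adicCompletion ↥(maximalRealSubfield L))), b ≠ 0 ∧
    Matrix.diagonal ![1, α] * ((((E₂ t₀.1 : ↥(unitaryGroupOfForm (galAdicCompletionMap (L := L) (IsCMField.complexConj L) hw) (placeForm (Matrix.of fun i j : Fin 2 => if i.val + j.val + 1 = 2 then (1 : L) else 0) w.1))) : GL (Fin 2) (w.1.adicCompletion L)) : Matrix (Fin 2) (Fin 2) (w.1.adicCompletion L))) * Matrix.diagonal ![1, α⁻¹] = s • (!![a, b * v₀; b, a + b * u₀]).map (toPlace v w))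

include hw he ht₀ hP hd1 hE₂ hα hα0 hv0 hτ hστ hτne hση hη0 hpos

-- `L_w`-sized statement and a long composition: elaboration budget only (no search)
set_option maxHeartbeats 1600000 in
/-- **HEAD — (B6-O) FILE B: THE DEPTH AND SIGN DICTIONARY ALONG THE TORUS.**  For the difference coordinate `bc` (★ p844144: `ι bc t = (x₀∕x₁ − x₁∕x₀)∕η` above `Nb`) and the
(B6-V) window depth `oT` with its coordinate spec (`∃ βF, ι βF = α·X₁₀∕X₀₀ ∧ |βF|_v = exp(−oT t)` above `mfl`, B-p14 (g33)): there are `M`, `k₁ : ℤ`, `c₀ ∈ L⁺_vˣ` with,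
for every regular `t`, `M ≤ N t`: **(hoT)** `|ι_w ↑(bc t)|_w = exp(−(2·oT t + 2·k₁))`, **(hnn)** `0 ≤ oT t + k₁`, and **(hsign)** `(↑(bc t·c₀), θ)_v = (βF, θ)_v` for EVERY `βF` with
`ι βF = α·X₁₀∕X₀₀` (the (B6-V) sign `κT t = (βF·n_t, θ)_v` with `(n_t, θ)_v = 1` then reads `(↑(bc t·c₀), θ)_v` by ★ `hilbertSymbol_mul_zpow_eq_of_eq_one`).
[cite: LabesseLanglands1979, §2 (2.1)–(2.2)] [cite: Labesse2024StabilisationGermesSL2, Prop. 0.0.11, Th. 0.0.12] [cite: Rogawski1990, §4.9 Lemma 4.9.3 p. 56] -/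
theorem exists_depth_sign_dictionary_torus
    (bc : ↥(Subgroup.centralizer ({t₀} : Set ((cmDatum L 2 (Matrix.of fun i j : Fin 2 => if i.val + j.val + 1 = 2 then (1 : L) else 0)).Local v × (cmDatum L 1 (Matrix.of fun i j : Fin 1 => if i.val + j.val + 1 = 1 then (1 : L) else 0)).Local v))) → ((v.adicCompletion ↥(maximalRealSubfield L)))ˣ) (Nb : ℕ)
    (hbc : ∀ t : ↥(Subgroup.centralizer ({t₀} : Set ((cmDatum L 2 (Matrix.of fun i j : Fin 2 => if i.val + j.val + 1 = 2 then (1 : L) else 0)).Local v × (cmDatum L 1 (Matrix.of fun i j : Fin 1 => if i.val + j.val + 1 = 1 then (1 : L) else 0)).Local v))), t ∈ {t : ↥(Subgroup.centralizer ({t₀} : Set ((cmDatum L 2 (Matrix.of fun i j : Fin 2 => if i.val + j.val + 1 = 2 then (1 : L) else 0)).Local v × (cmDatum L 1 (Matrix.of fun i j : Fin 1 => if i.val + j.val + 1 = 1 then (1 : L) else 0)).Local v))) | IsRegularElt ((t : ((cmDatum L 2 (Matrix.of fun i j : Fin 2 => if i.val + j.val + 1 = 2 then (1 : L) else 0)).Local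 v × (cmDatum L 1 (Matrix.of fun i j : Fin 1 => if i.val + j.val + 1 = 1 then (1 : L) else 0)).Local v)).1.val : GL (Fin 2) (LocalRing L v))} → Nb ≤ (-WithZero.log (Valued.v ((((P⁻¹).val * ((t : ((cmDatum L 2 (Matrix.of fun i j : Fin 2 => if i.val + j.val + 1 = 2 then (1 : L) else 0)).Local v × (cmDatum L 1 (Matrix.of fun i j : Fin 1 => if i.val + j.val + 1 = 1 then (1 : L) else 0)).Local v)).1.val.val : Matrix (Fin 2) (Fin 2) (LocalRing L v)) * P.val) 0 0 - ((P⁻¹).val * ((t : ((cmDatum L 2 (Matrix.of fun i j : Fin 2 => if i.val + j.val + 1 = 2 then (1 : L) else 0)).Local v × (cmDatum L 1 (Matrix.of fun i j : Fin 1 => if i.val + j.val + 1 = 1 then (1 : L) else 0)).Local v)).1.val.val : Matrix (Fin 2) (Fin 2) (LocalRing L v)) * P.val) 1 1) w))).toNat →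
      toPlace v w ((bc t : ((v.adicCompletion ↥(maximalRealSubfield L)))ˣ) : (v.adicCompletion ↥(maximalRealSubfield L))) = (((P⁻¹).val * ((t : ((cmDatum L 2 (Matrix.of fun i j : Fin 2 => if i.val + j.val + 1 = 2 then (1 : L) else 0)).Local v × (cmDatum L 1 (Matrix.of fun i j : Fin 1 => if i.val + j.val + 1 = 1 then (1 : L) else 0)).Local v)).1.val.val : Matrix (Fin 2) (Fin 2) (LocalRing L v)) * P.val) 0 0 w / ((P⁻¹).val * ((t : ((cmDatum L 2 (Matrix.of fun i j : Fin 2 => if i.val + j.val + 1 = 2 then (1 : L) else 0)).Local v × (cmDatum L 1 (Matrix.of fun i j : Fin 1 => if i.val + j.val + 1 = 1 then (1 : L) else 0)).Local v)).1.val.val : Matrix (Fin 2) (Fin 2) (LocalRing L v)) * P.val) 1 1 w - ((P⁻¹).val * ((t : ((cmDatum L 2 (Matrix.of fun i j : Fin 2 => if i.val + j.val + 1 = 2 then (1 : L) else 0)).Local v × (cmDatum L 1 (Matrix.of fun i j : Fin 1 => if i.val + j.val + 1 = 1 then (1 : L) else 0)).Local v)).1.val.val : Matrix (Fin 2) (Fin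 2) (LocalRing L v)) * P.val) 1 1 w / ((P⁻¹).val * ((t : ((cmDatum L 2 (Matrix.of fun i j : Fin 2 => if i.val + j.val + 1 = 2 then (1 : L) else 0)).Local v × (cmDatum L 1 (Matrix.of fun i j : Fin 1 => if i.val + j.val + 1 = 1 then (1 : L) else 0)).Local v)).1.val.val : Matrix (Fin 2) (Fin 2) (LocalRing L v)) * P.val) 0 0 w) / η)
    (mfl : ℕ) (oT : ↥(Subgroup.centralizer ({t₀} : Set ((cmDatum L 2 (Matrix.of fun i j : Fin 2 => if i.val + j.val + 1 = 2 then (1 : L) else 0)).Local v × (cmDatum L 1 (Matrix.of fun i j : Fin 1 => if i.val + j.val + 1 = 1 then (1 : L) else 0)).Local v))) → ℕ)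
    (hβspec : ∀ t : ↥(Subgroup.centralizer ({t₀} : Set ((cmDatum L 2 (Matrix.of fun i j : Fin 2 => if i.val + j.val + 1 = 2 then (1 : L) else 0)).Local v × (cmDatum L 1 (Matrix.of fun i j : Fin 1 => if i.val + j.val + 1 = 1 then (1 : L) else 0)).Local v))), t ∈ {t : ↥(Subgroup.centralizer ({t₀} : Set ((cmDatum L 2 (Matrix.of fun i j : Fin 2 => if i.val + j.val + 1 = 2 then (1 : L) else 0)).Local v × (cmDatum L 1 (Matrix.of fun i j : Fin 1 => if i.val + j.val + 1 = 1 then (1 : L) else 0)).Local v))) | IsRegularElt ((t : ((cmDatum L 2 (Matrix.of fun i j : Fin 2 => if i.val + j.val + 1 = 2 then (1 : L) else 0)).Local v × (cmDatum L 1 (Matrix.of fun i j : Fin 1 => if i.val + j.val + 1 = 1 then (1 : L) else 0)).Local v)).1.val : GL (Fin 2) (LocalRing L v))} → mfl ≤ (-WithZero.log (Valued.v ((((P⁻¹).val * ((t : ((cmDatum L 2 (Matrix.of fun i j : Fin 2 => if i.val + j.val + 1 = 2 then (1 : L) else 0)).Local v × (cmDatum L 1 (Matrix.of fun i j : Fin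 1 => if i.val + j.val + 1 = 1 then (1 : L) else 0)).Local v)).1.val.val : Matrix (Fin 2) (Fin 2) (LocalRing L v)) * P.val) 0 0 - ((P⁻¹).val * ((t : ((cmDatum L 2 (Matrix.of fun i j : Fin 2 => if i.val + j.val + 1 = 2 then (1 : L) else 0)).Local v × (cmDatum L 1 (Matrix.of fun i j : Fin 1 => if i.val + j.val + 1 = 1 then (1 : L) else 0)).Local v)).1.val.val : Matrix (Fin 2) (Fin 2) (LocalRing L v)) * P.val) 1 1) w))).toNat →
      ∃ βF : (v.adicCompletion ↥(maximalRealSubfield L)), toPlace v w βF = α * ((((E₂ (t : ((cmDatum L 2 (Matrix.of fun i j : Fin 2 => if i.val + j.val + 1 = 2 then (1 : L) else 0)).Local v × (cmDatum L 1 (Matrix.of fun i j : Fin 1 => if i.val + j.val + 1 = 1 then (1 : L) else 0)).Local v)).1 : ↥(unitaryGroupOfForm (galAdicCompletionMap (L := L) (IsCMField.complexConj L) hw) (placeForm (Matrix.of fun i j : Fin 2 => if i.val + j.val + 1 = 2 then (1 : L) else 0) w.1))) : GL (Fin 2) (w.1.adicCompletion L)) : Matrix (Fin 2) (Fin 2)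 (w.1.adicCompletion L))) 1 0 / ((((E₂ (t : ((cmDatum L 2 (Matrix.of fun i j : Fin 2 => if i.val + j.val + 1 = 2 then (1 : L) else 0)).Local v × (cmDatum L 1 (Matrix.of fun i j : Fin 1 => if i.val + j.val + 1 = 1 then (1 : L) else 0)).Local v)).1 : ↥(unitaryGroupOfForm (galAdicCompletionMap (L := L) (IsCMField.complexConj L) hw) (placeForm (Matrix.of fun i j : Fin 2 => if i.val + j.val + 1 = 2 then (1 : L) else 0) w.1))) : GL (Fin 2) (w.1.adicCompletion L)) : Matrix (Fin 2) (Fin 2) (w.1.adicCompletion L))) 0 0 ∧ Valued.v βF = WithZero.exp (-(oT t : ℤ))) :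
    ∃ (M : ℕ) (k₁ : ℤ) (c₀ : ((v.adicCompletion ↥(maximalRealSubfield L)))ˣ), ∀ t : ↥(Subgroup.centralizer ({t₀} : Set ((cmDatum L 2 (Matrix.of fun i j : Fin 2 => if i.val + j.val + 1 = 2 then (1 : L) else 0)).Local v × (cmDatum L 1 (Matrix.of fun i j : Fin 1 => if i.val + j.val + 1 = 1 then (1 : L) else 0)).Local v))), t ∈ {t : ↥(Subgroup.centralizer ({t₀} : Set ((cmDatum L 2 (Matrix.of fun i j : Fin 2 => if i.val + j.val + 1 = 2 then (1 : L) else 0)).Local v × (cmDatum L 1 (Matrix.of fun i j : Fin 1 => if i.val + j.val + 1 = 1 then (1 : L) else 0)).Local v))) | IsRegularElt ((t : ((cmDatum L 2 (Matrix.of fun i j : Fin 2 => if i.val + j.val + 1 = 2 then (1 : L) else 0)).Local v × (cmDatum L 1 (Matrix.of fun i j : Fin 1 => if i.val + j.val + 1 = 1 then (1 : L) else 0)).Local v)).1.val : GL (Fin 2) (LocalRing L v))} → M ≤ (-WithZero.log (Valued.v ((((P⁻¹).val * ((t : ((cmDatum L 2 (Matrix.of fun i j : Fin 2 => if i.val +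 j.val + 1 = 2 then (1 : L) else 0)).Local v × (cmDatum L 1 (Matrix.of fun i j : Fin 1 => if i.val + j.val + 1 = 1 then (1 : L) else 0)).Local v)).1.val.val : Matrix (Fin 2) (Fin 2) (LocalRing L v)) * P.val) 0 0 - ((P⁻¹).val * ((t : ((cmDatum L 2 (Matrix.of fun i j : Fin 2 => if i.val + j.val + 1 = 2 then (1 : L) else 0)).Local v × (cmDatum L 1 (Matrix.of fun i j : Fin 1 => if i.val + j.val + 1 = 1 then (1 : L) else 0)).Local v)).1.val.val : Matrix (Fin 2) (Fin 2) (LocalRing L v)) * P.val) 1 1) w))).toNat →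
      Valued.v (toPlace v w ((bc t : ((v.adicCompletion ↥(maximalRealSubfield L)))ˣ) : (v.adicCompletion ↥(maximalRealSubfield L)))) = WithZero.exp (-(2 * (oT t : ℤ) + 2 * k₁)) ∧
      0 ≤ (oT t : ℤ) + k₁ ∧
      ∀ βF : (v.adicCompletion ↥(maximalRealSubfield L)), toPlace v w βF = α * ((((E₂ (t : ((cmDatum L 2 (Matrix.of fun i j : Fin 2 => if i.val + j.val + 1 = 2 then (1 : L) else 0)).Local v × (cmDatum L 1 (Matrix.of fun i j : Fin 1 => if i.val + j.val + 1 = 1 then (1 : L) else 0)).Local v)).1 : ↥(unitaryGroupOfForm (galAdicCompletionMap (L := L) (IsCMField.complexConj L) hw) (placeForm (Matrix.of fun i j : Fin 2 => if i.val + j.val + 1 = 2 then (1 : L) else 0) w.1))) : GL (Fin 2) (w.1.adicCompletion L)) : Matrix (Fin 2) (Fin 2) (w.1.adicCompletion L))) 1 0 / ((((E₂ (t : ((cmDatum L 2 (Matrix.of fun i j : Fin 2 => if i.val + j.val + 1 = 2 then (1 : L) else 0)).Local v × (cmDatum L 1 (Matrix.of fun i j : Fin 1 => if i.val + j.val + 1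 = 1 then (1 : L) else 0)).Local v)).1 : ↥(unitaryGroupOfForm (galAdicCompletionMap (L := L) (IsCMField.complexConj L) hw) (placeForm (Matrix.of fun i j : Fin 2 => if i.val + j.val + 1 = 2 then (1 : L) else 0) w.1))) : GL (Fin 2) (w.1.adicCompletion L)) : Matrix (Fin 2) (Fin 2) (w.1.adicCompletion L))) 0 0 →
        hilbertSymbol (v.adicCompletion ↥(maximalRealSubfield L)) (((bc t * c₀ : ((v.adicCompletion ↥(maximalRealSubfield L)))ˣ)) : (v.adicCompletion ↥(maximalRealSubfield L))) (algebraMap ↥(maximalRealSubfield L) _ ((cmQuadraticGenerator L : 𝓞 ↥(maximalRealSubfield L)) : ↥(maximalRealSubfield L))) = hilbertSymbol (v.adicCompletion ↥(maximalRealSubfield L)) βF (algebraMap ↥(maximalRealSubfield L) _ ((cmQuadraticGenerator L : 𝓞 ↥(maximalRealSubfield L)) : ↥(maximalRealSubfield L))) := by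
  classical
  haveI : CharZero (w.1.adicCompletion L) := charZero_of_injective_algebraMap (algebraMap L (w.1.adicCompletion L)).injective
  -- the Eisenstein pair `(τE, (galAdicCompletionMap (L := L) (IsCMField.complexConj L) hw) τE)`
  have hsum : τE + (galAdicCompletionMap (L := L) (IsCMField.complexConj L) hw) τE = (toPlace v w) u₀ := by rw [hστ]; ring
  have hprod : τE * (galAdicCompletionMap (L := L) (IsCMField.complexConj L) hw) τE = -(toPlace v w) v₀ := by rw [hστ]; linear_combination -hτ
  have hσσ : (galAdicCompletionMap (L := L) (IsCMField.complexConj L) hw) ((galAdicCompletionMap (L := L) (IsCMField.complexConj L) hw) τE) = τE := galAdicCompletionMap_complexConj_self L v w hw τE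
  have hsum' : (galAdicCompletionMap (L := L) (IsCMField.complexConj L) hw) τE + (galAdicCompletionMap (L := L) (IsCMField.complexConj L) hw) ((galAdicCompletionMap (L := L) (IsCMField.complexConj L) hw) τE) = (toPlace v w) u₀ := by rw [hσσ, add_comm]; exact hsum
  have hprod' : (galAdicCompletionMap (L := L) (IsCMField.complexConj L) hw) τE * (galAdicCompletionMap (L := L) (IsCMField.complexConj L) hw) ((galAdicCompletionMap (L := L) (IsCMField.complexConj L) hw) τE) = -(toPlace v w) v₀ := by rw [hσσ, mul_comm]; exact hprod
  have hτne' : (galAdicCompletionMap (L := L) (IsCMField.complexConj L) hw) τE ≠ (galAdicCompletionMap (L := L) (IsCMField.complexConj L) hw) ((galAdicCompletionMap (L := L) (IsCMField.complexConj L) hw) τE) := by rw [hσσ]; exact fun h => hτne h.symm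
  have hτd0 : τE - (galAdicCompletionMap (L := L) (IsCMField.complexConj L) hw) τE ≠ 0 := sub_ne_zero.2 hτne
  -- the `t`-free constant `c′` with `(toPlace v w) c′ = (τE − (galAdicCompletionMap (L := L) (IsCMField.complexConj L) hw) τE)∕η` (skew ∕ skew is fixed)
  have hskew : (galAdicCompletionMap (L := L) (IsCMField.complexConj L) hw) (τE - (galAdicCompletionMap (L := L) (IsCMField.complexConj L) hw) τE) = -(τE - (galAdicCompletionMap (L := L) (IsCMField.complexConj L) hw) τE) := by rw [map_sub, hσσ]; ring
  have hfix : (galAdicCompletionMap (L := L) (IsCMField.complexConj L) hw) ((τE - (galAdicCompletionMap (L := L) (IsCMField.complexConj L) hw) τE) / η) = (τE - (galAdicCompletionMap (L := L) (IsCMField.complexConj L) hw) τE) / η := galAdicCompletionMap_div_eq_self_of_skew L v w hw hskew hση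
  obtain ⟨c', hc'⟩ := exists_toPlace_eq_of_galAdicCompletionMap_eq (IsCMField.complexConj L) w (IsCMField.complexConj_ne_one L) hw _ hfix
  have hc'0 : c' ≠ 0 := by
    intro h0; rw [h0, map_zero, eq_comm, div_eq_zero_iff] at hc'; exact hc'.elim hτd0 hη0
  have h2c'0 : (2 : (v.adicCompletion ↥(maximalRealSubfield L))) * c' ≠ 0 := mul_ne_zero two_ne_zero hc'0
  have hc'' : (toPlace v w) (-c') = ((galAdicCompletionMap (L := L) (IsCMField.complexConj L) hw) τE - (galAdicCompletionMap (L := L) (IsCMField.complexConj L) hw) ((galAdicCompletionMap (L := L) (IsCMField.complexConj L) hw) τE)) / η := by rw [map_neg, hc', hσσ]; ring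
  -- the frame `Q := P_w` and `D := diag(1, α)`
  set Pw : GL (Fin 2) (w.1.adicCompletion L) := Matrix.GeneralLinearGroup.map (Pi.evalRingHom (fun w' : PlacesOver L v => w'.1.adicCompletion L) w) P with hPwdef
  have hQu : IsUnit (Pw : Matrix (Fin 2) (Fin 2) (w.1.adicCompletion L)).det := (Matrix.isUnit_iff_isUnit_det _).1 Pw.isUnit
  have hDD : Matrix.diagonal ![(1 : (w.1.adicCompletion L)), α⁻¹] * Matrix.diagonal ![1, α] = 1 := by
    rw [Matrix.diagonal_mul_diagonal, ← Matrix.diagonal_one]; congr 1; ext i; fin_cases i <;> simp [inv_mul_cancel₀ hα0]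
  have hDD' : Matrix.diagonal ![(1 : (w.1.adicCompletion L)), α] * Matrix.diagonal ![1, α⁻¹] = 1 := by
    rw [Matrix.diagonal_mul_diagonal, ← Matrix.diagonal_one]; congr 1; ext i; fin_cases i <;> simp [mul_inv_cancel₀ hα0]
  have hDu : IsUnit (Matrix.diagonal ![(1 : (w.1.adicCompletion L)), α]).det := by
    rw [Matrix.det_diagonal, Fin.prod_univ_two]; simp [hα0]
  -- descent along the torus
  have hdesc := forall_exists_descent_eq_smul_regRep_of_pos L v w hw hα hα0 E₂ t₀ hv0 hpos
  -- per-`t` frame at `w`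
  have hframe : ∀ t : ↥(Subgroup.centralizer ({t₀} : Set ((cmDatum L 2 (Matrix.of fun i j : Fin 2 => if i.val + j.val + 1 = 2 then (1 : L) else 0)).Local v × (cmDatum L 1 (Matrix.of fun i j : Fin 1 => if i.val + j.val + 1 = 1 then (1 : L) else 0)).Local v))), ((((E₂ (t : ((cmDatum L 2 (Matrix.of fun i j : Fin 2 => if i.val + j.val + 1 = 2 then (1 : L) else 0)).Local v × (cmDatum L 1 (Matrix.of fun i j : Fin 1 => if i.val + j.val + 1 = 1 then (1 : L) else 0)).Local v)).1 : ↥(unitaryGroupOfForm (galAdicCompletionMap (L := L) (IsCMField.complexConj L) hw) (placeForm (Matrix.of fun i j : Fin 2 => if i.val + j.val + 1 = 2 then (1 : L) else 0) w.1))) : GL (Fin 2) (w.1.adicCompletion L)) : Matrix (Fin 2) (Fin 2) (w.1.adicCompletion L))) * (Pw : Matrix (Fin 2) (Fin 2) (w.1.adicCompletion L)) = (Pw : Matrix (Fin 2) (Fin 2) (w.1.adicCompletion L)) * Matrix.diagonal ![((P⁻¹).val * ((t : ((cmDatum L 2 (Matrix.of fun i j : Fin 2 => if i.val + j.val + 1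 = 2 then (1 : L) else 0)).Local v × (cmDatum L 1 (Matrix.of fun i j : Fin 1 => if i.val + j.val + 1 = 1 then (1 : L) else 0)).Local v)).1.val.val : Matrix (Fin 2) (Fin 2) (LocalRing L v)) * P.val) 0 0 w, ((P⁻¹).val * ((t : ((cmDatum L 2 (Matrix.of fun i j : Fin 2 => if i.val + j.val + 1 = 2 then (1 : L) else 0)).Local v × (cmDatum L 1 (Matrix.of fun i j : Fin 1 => if i.val + j.val + 1 = 1 then (1 : L) else 0)).Local v)).1.val.val : Matrix (Fin 2) (Fin 2) (LocalRing L v)) * P.val) 1 1 w] := by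
    intro t
    have hPt := frame_of_mem_centralizer L v w hw t₀ P d ht₀ hP hd1 t
    have hTt := coe_localNonsplitEquiv_mul_map_eq L v w hw (t : ((cmDatum L 2 (Matrix.of fun i j : Fin 2 => if i.val + j.val + 1 = 2 then (1 : L) else 0)).Local v × (cmDatum L 1 (Matrix.of fun i j : Fin 1 => if i.val + j.val + 1 = 1 then (1 : L) else 0)).Local v)).1 P _ hPt
    rw [← hE₂, ← hPwdef, Matrix.diagonal_map (map_zero _)] at hTt
    have hdτ : (Matrix.diagonal fun i => Pi.evalRingHom (fun w' : PlacesOver L v => w'.1.adicCompletion L) w (![((P⁻¹).val * ((t : ((cmDatum L 2 (Matrix.of fun i j : Fin 2 => if i.val + j.val + 1 = 2 then (1 : L) else 0)).Local v × (cmDatum L 1 (Matrix.of fun i j : Fin 1 => if i.val + j.val + 1 = 1 then (1 : L) else 0)).Local v)).1.val.val : Matrix (Fin 2) (Fin 2) (LocalRing L v)) * P.val) 0 0, ((P⁻¹).val * ((t : ((cmDatum L 2 (Matrix.of fun i j : Fin 2 => if i.val + j.val + 1 = 2 then (1 : L) else 0)).Local v × (cmDatum L 1 (Matrix.of fun i j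 : Fin 1 => if i.val + j.val + 1 = 1 then (1 : L) else 0)).Local v)).1.val.val : Matrix (Fin 2) (Fin 2) (LocalRing L v)) * P.val) 1 1] i)) = Matrix.diagonal ![((P⁻¹).val * ((t : ((cmDatum L 2 (Matrix.of fun i j : Fin 2 => if i.val + j.val + 1 = 2 then (1 : L) else 0)).Local v × (cmDatum L 1 (Matrix.of fun i j : Fin 1 => if i.val + j.val + 1 = 1 then (1 : L) else 0)).Local v)).1.val.val : Matrix (Fin 2) (Fin 2) (LocalRing L v)) * P.val) 0 0 w, ((P⁻¹).val * ((t : ((cmDatum L 2 (Matrix.of fun i j : Fin 2 => if i.val + j.val + 1 = 2 then (1 : L) else 0)).Local v × (cmDatum L 1 (Matrix.of fun i j : Fin 1 => if i.val + j.val + 1 = 1 then (1 : L) else 0)).Local v)).1.val.val : Matrix (Fin 2) (Fin 2) (LocalRing L v)) * P.val) 1 1 w] := by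
      congr 1; funext i; fin_cases i <;> rfl
    rw [hdτ] at hTt
    exact hTt
  -- thresholds, read off `N t`
  have h2 : (2 : (w.1.adicCompletion L)) ≠ 0 := two_ne_zero
  have hστ0 : (galAdicCompletionMap (L := L) (IsCMField.complexConj L) hw) τE ≠ 0 := by
    intro h0
    have : τE = 0 := by rw [← hσσ, h0, map_zero]
    exact hτne (by rw [this, map_zero])
  obtain ⟨π₁, hπ₁0, hπ₁⟩ : ∃ π₁ : (w.1.adicCompletion L), π₁ ≠ 0 ∧ π₁ * (galAdicCompletionMap (L := L) (IsCMField.complexConj L) hw) τE = τE - (galAdicCompletionMap (L := L) (IsCMField.complexConj L) hw) τE := ⟨(τE - (galAdicCompletionMap (L := L) (IsCMField.complexConj L) hw) τE) / (galAdicCompletionMap (L := L) (IsCMField.complexConj L) hw) τE, div_ne_zero hτd0 hστ0, div_mul_cancel₀ _ hστ0⟩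
  obtain ⟨π₂, hπ₂0, hπ₂⟩ : ∃ π₂ : (w.1.adicCompletion L), π₂ ≠ 0 ∧ (u₀ ≠ 0 → π₂ * (toPlace v w) u₀ = 8 * (τE - (galAdicCompletionMap (L := L) (IsCMField.complexConj L) hw) τE)) := by
    by_cases hu : u₀ = 0
    · exact ⟨1, one_ne_zero, fun h => absurd hu h⟩
    · exact ⟨8 * (τE - (galAdicCompletionMap (L := L) (IsCMField.complexConj L) hw) τE) / (toPlace v w) u₀, div_ne_zero (mul_ne_zero (by norm_num) hτd0) ((map_ne_zero (toPlace v w)).2 hu), fun _ => div_mul_cancel₀ _ ((map_ne_zero (toPlace v w)).2 hu)⟩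
  obtain ⟨π₃, hπ₃0, hπ₃⟩ : ∃ π₃ : (w.1.adicCompletion L), π₃ ≠ 0 ∧ π₃ * 2 = η := ⟨η / 2, div_ne_zero hη0 h2, div_mul_cancel₀ _ h2⟩
  obtain ⟨M, hM⟩ : ∃ M : ℕ, Nb ≤ M ∧ mfl ≤ M ∧ (-WithZero.log (Valued.v π₁)).toNat + 1 ≤ M ∧ (-WithZero.log (Valued.v π₂)).toNat + 1 ≤ M ∧
      (-WithZero.log (Valued.v π₃)).toNat + 1 ≤ M ∧ (-WithZero.log (Valued.v (2 : (w.1.adicCompletion L)))).toNat + 1 ≤ M :=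
    ⟨Nb + mfl + ((-WithZero.log (Valued.v π₁)).toNat + 1) + ((-WithZero.log (Valued.v π₂)).toNat + 1) + ((-WithZero.log (Valued.v π₃)).toNat + 1) +
      ((-WithZero.log (Valued.v (2 : (w.1.adicCompletion L)))).toNat + 1), by omega, by omega, by omega, by omega, by omega, by omega⟩
  -- PER-`t` PACKAGE on the deep regular locus: descent, frame column, eigenvalue sizes, deepness, `|(toPlace v w) bc| ≤ 1`
  have hper : ∀ t : ↥(Subgroup.centralizer ({t₀} : Set ((cmDatum L 2 (Matrix.of fun i j : Fin 2 => if i.val + j.val + 1 = 2 then (1 : L) else 0)).Local v × (cmDatum L 1 (Matrix.of fun i j : Fin 1 => if i.val + j.val + 1 = 1 then (1 : L) else 0)).Local v))), t ∈ {t : ↥(Subgroup.centralizer ({t₀} : Set ((cmDatum L 2 (Matrix.of fun i j : Fin 2 => if i.val + j.val + 1 = 2 then (1 : L) else 0)).Local v × (cmDatum L 1 (Matrix.of fun i j : Fin 1 => if i.val + j.val + 1 = 1 then (1 : L) else 0)).Local v))) | IsRegularElt ((t : ((cmDatum L 2 (Matrix.of fun i j : Fin 2 => if i.val + j.val + 1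 = 2 then (1 : L) else 0)).Local v × (cmDatum L 1 (Matrix.of fun i j : Fin 1 => if i.val + j.val + 1 = 1 then (1 : L) else 0)).Local v)).1.val : GL (Fin 2) (LocalRing L v))} → M ≤ (-WithZero.log (Valued.v ((((P⁻¹).val * ((t : ((cmDatum L 2 (Matrix.of fun i j : Fin 2 => if i.val + j.val + 1 = 2 then (1 : L) else 0)).Local v × (cmDatum L 1 (Matrix.of fun i j : Fin 1 => if i.val + j.val + 1 = 1 then (1 : L) else 0)).Local v)).1.val.val : Matrix (Fin 2) (Fin 2) (LocalRing L v)) * P.val) 0 0 - ((P⁻¹).val * ((t : ((cmDatum L 2 (Matrix.of fun i j : Fin 2 => if i.val + j.val + 1 = 2 then (1 : L) else 0)).Local v × (cmDatum L 1 (Matrix.of fun i j : Fin 1 => if i.val + j.val + 1 = 1 then (1 : L) else 0)).Local v)).1.val.val : Matrix (Fin 2) (Fin 2) (LocalRing L v)) * P.val) 1 1) w))).toNat →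
      ∃ (s : (w.1.adicCompletion L)) (a b : (v.adicCompletion ↥(maximalRealSubfield L))),
        Matrix.diagonal ![1, α] * ((((E₂ (t : ((cmDatum L 2 (Matrix.of fun i j : Fin 2 => if i.val + j.val + 1 = 2 then (1 : L) else 0)).Local v × (cmDatum L 1 (Matrix.of fun i j : Fin 1 => if i.val + j.val + 1 = 1 then (1 : L) else 0)).Local v)).1 : ↥(unitaryGroupOfForm (galAdicCompletionMap (L := L) (IsCMField.complexConj L) hw) (placeForm (Matrix.of fun i j : Fin 2 => if i.val + j.val + 1 = 2 then (1 : L) else 0) w.1))) : GL (Fin 2) (w.1.adicCompletion L)) : Matrix (Fin 2) (Fin 2) (w.1.adicCompletion L))) * Matrix.diagonal ![1, α⁻¹] = s • (!![a, b * v₀; b, a + b * u₀]).map (toPlace v w) ∧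
        (Matrix.diagonal ![1, α] * (Pw : Matrix (Fin 2) (Fin 2) (w.1.adicCompletion L))) 1 0 ≠ 0 ∧
        ((Matrix.diagonal ![1, α] * (Pw : Matrix (Fin 2) (Fin 2) (w.1.adicCompletion L))) 0 0 = -((galAdicCompletionMap (L := L) (IsCMField.complexConj L) hw) τE) * (Matrix.diagonal ![1, α] * (Pw : Matrix (Fin 2) (Fin 2) (w.1.adicCompletion L))) 1 0 ∨ (Matrix.diagonal ![1, α] * (Pw : Matrix (Fin 2) (Fin 2) (w.1.adicCompletion L))) 0 0 = -τE * (Matrix.diagonal ![1, α] * (Pw : Matrix (Fin 2) (Fin 2) (w.1.adicCompletion L))) 1 0) ∧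
        Valued.v (((P⁻¹).val * ((t : ((cmDatum L 2 (Matrix.of fun i j : Fin 2 => if i.val + j.val + 1 = 2 then (1 : L) else 0)).Local v × (cmDatum L 1 (Matrix.of fun i j : Fin 1 => if i.val + j.val + 1 = 1 then (1 : L) else 0)).Local v)).1.val.val : Matrix (Fin 2) (Fin 2) (LocalRing L v)) * P.val) 1 1 w) = 1 ∧ ((P⁻¹).val * ((t : ((cmDatum L 2 (Matrix.of fun i j : Fin 2 => if i.val + j.val + 1 = 2 then (1 : L) else 0)).Local v × (cmDatum L 1 (Matrix.of fun i j : Fin 1 => if i.val + j.val + 1 = 1 then (1 : L) else 0)).Local v)).1.val.val : Matrix (Fin 2) (Fin 2) (LocalRing L v)) * P.val) 0 0 w ≠ ((P⁻¹).val * ((t : ((cmDatum L 2 (Matrix.of fun i j : Fin 2 => if i.val + j.val + 1 = 2 then (1 : L) else 0)).Local v × (cmDatum L 1 (Matrix.of fun i j : Fin 1 => if i.val + j.val + 1 = 1 then (1 : L) else 0)).Local v)).1.val.val : Matrix (Fin 2) (Fin 2) (LocalRing L v)) * P.val) 1 1 w ∧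
        Valued.v (((P⁻¹).val * ((t : ((cmDatum L 2 (Matrix.of fun i j : Fin 2 => if i.val + j.val + 1 = 2 then (1 : L) else 0)).Local v × (cmDatum L 1 (Matrix.of fun i j : Fin 1 => if i.val + j.val + 1 = 1 then (1 : L) else 0)).Local v)).1.val.val : Matrix (Fin 2) (Fin 2) (LocalRing L v)) * P.val) 0 0 w - ((P⁻¹).val * ((t : ((cmDatum L 2 (Matrix.of fun i j : Fin 2 => if i.val + j.val + 1 = 2 then (1 : L) else 0)).Local v × (cmDatum L 1 (Matrix.of fun i j : Fin 1 => if i.val + j.val + 1 = 1 then (1 : L) else 0)).Local v)).1.val.val : Matrix (Fin 2) (Fin 2) (LocalRing L v)) * P.val) 1 1 w) * Valued.v ((galAdicCompletionMap (L := L) (IsCMField.complexConj L) hw) τE) < Valued.v (τE - (galAdicCompletionMap (L := L) (IsCMField.complexConj L) hw) τE) ∧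
        Valued.v (((P⁻¹).val * ((t : ((cmDatum L 2 (Matrix.of fun i j : Fin 2 => if i.val + j.val + 1 = 2 then (1 : L) else 0)).Local v × (cmDatum L 1 (Matrix.of fun i j : Fin 1 => if i.val + j.val + 1 = 1 then (1 : L) else 0)).Local v)).1.val.val : Matrix (Fin 2) (Fin 2) (LocalRing L v)) * P.val) 0 0 w - ((P⁻¹).val * ((t : ((cmDatum L 2 (Matrix.of fun i j : Fin 2 => if i.val + j.val + 1 = 2 then (1 : L) else 0)).Local v × (cmDatum L 1 (Matrix.of fun i j : Fin 1 => if i.val + j.val + 1 = 1 then (1 : L) else 0)).Local v)).1.val.val : Matrix (Fin 2) (Fin 2) (LocalRing L v)) * P.val) 1 1 w) * Valued.v ((toPlace v w) u₀) < Valued.v (8 : (w.1.adicCompletion L)) * Valued.v (τE - (galAdicCompletionMap (L := L) (IsCMField.complexConj L) hw) τE) ∧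
        Valued.v (toPlace v w ((bc t : ((v.adicCompletion ↥(maximalRealSubfield L)))ˣ) : (v.adicCompletion ↥(maximalRealSubfield L)))) ≤ 1 ∧ Nb ≤ (-WithZero.log (Valued.v ((((P⁻¹).val * ((t : ((cmDatum L 2 (Matrix.of fun i j : Fin 2 => if i.val + j.val + 1 = 2 then (1 : L) else 0)).Local v × (cmDatum L 1 (Matrix.of fun i j : Fin 1 => if i.val + j.val + 1 = 1 then (1 : L) else 0)).Local v)).1.val.val : Matrix (Fin 2) (Fin 2) (LocalRing L v)) * P.val) 0 0 - ((P⁻¹).val * ((t : ((cmDatum L 2 (Matrix.of fun i j : Fin 2 => if i.val + j.val + 1 = 2 then (1 : L) else 0)).Local v × (cmDatum L 1 (Matrix.of fun i j : Fin 1 => if i.val + j.val + 1 = 1 then (1 : L) else 0)).Local v)).1.val.val : Matrix (Fin 2) (Fin 2) (LocalRing L v)) * P.val) 1 1) w))).toNat ∧ mfl ≤ (-WithZero.log (Valued.v ((((P⁻¹).val * ((t : ((cmDatum L 2 (Matrix.of fun i j : Fin 2 => if i.val + j.val + 1 = 2 then (1 : L) else 0)).Local v × (cmDatum L 1 (Matrix.of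 fun i j : Fin 1 => if i.val + j.val + 1 = 1 then (1 : L) else 0)).Local v)).1.val.val : Matrix (Fin 2) (Fin 2) (LocalRing L v)) * P.val) 0 0 - ((P⁻¹).val * ((t : ((cmDatum L 2 (Matrix.of fun i j : Fin 2 => if i.val + j.val + 1 = 2 then (1 : L) else 0)).Local v × (cmDatum L 1 (Matrix.of fun i j : Fin 1 => if i.val + j.val + 1 = 1 then (1 : L) else 0)).Local v)).1.val.val : Matrix (Fin 2) (Fin 2) (LocalRing L v)) * P.val) 1 1) w))).toNat := by
    intro t ht hMt
    have hreg : IsRegularElt ((t : ((cmDatum L 2 (Matrix.of fun i j : Fin 2 => if i.val + j.val + 1 = 2 then (1 : L) else 0)).Local v × (cmDatum L 1 (Matrix.of fun i j : Fin 1 => if i.val + j.val + 1 = 1 then (1 : L) else 0)).Local v)).1.val : GL (Fin 2) (LocalRing L v)) := ht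
    have hNb : Nb ≤ (-WithZero.log (Valued.v ((((P⁻¹).val * ((t : ((cmDatum L 2 (Matrix.of fun i j : Fin 2 => if i.val + j.val + 1 = 2 then (1 : L) else 0)).Local v × (cmDatum L 1 (Matrix.of fun i j : Fin 1 => if i.val + j.val + 1 = 1 then (1 : L) else 0)).Local v)).1.val.val : Matrix (Fin 2) (Fin 2) (LocalRing L v)) * P.val) 0 0 - ((P⁻¹).val * ((t : ((cmDatum L 2 (Matrix.of fun i j : Fin 2 => if i.val + j.val + 1 = 2 then (1 : L) else 0)).Local v × (cmDatum L 1 (Matrix.of fun i j : Fin 1 => if i.val + j.val + 1 = 1 then (1 : L) else 0)).Local v)).1.val.val : Matrix (Fin 2) (Fin 2) (LocalRing L v)) * P.val) 1 1) w))).toNat := le_trans hM.1 hMt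
    have hmfl : mfl ≤ (-WithZero.log (Valued.v ((((P⁻¹).val * ((t : ((cmDatum L 2 (Matrix.of fun i j : Fin 2 => if i.val + j.val + 1 = 2 then (1 : L) else 0)).Local v × (cmDatum L 1 (Matrix.of fun i j : Fin 1 => if i.val + j.val + 1 = 1 then (1 : L) else 0)).Local v)).1.val.val : Matrix (Fin 2) (Fin 2) (LocalRing L v)) * P.val) 0 0 - ((P⁻¹).val * ((t : ((cmDatum L 2 (Matrix.of fun i j : Fin 2 => if i.val + j.val + 1 = 2 then (1 : L) else 0)).Local v × (cmDatum L 1 (Matrix.of fun i j : Fin 1 => if i.val + j.val + 1 = 1 then (1 : L) else 0)).Local v)).1.val.val : Matrix (Fin 2) (Fin 2) (LocalRing L v)) * P.val) 1 1) w))).toNat := le_trans hM.2.1 hMt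
    have hbct := hbc t ht hNb
    obtain ⟨s, γ, a, b, hγ, hG⟩ := hdesc t
    rw [hγ] at hG
    have ha1 := conjLocal_frameEntry_mul_self_apply L v w hw t₀ P d ht₀ hP hd1 t 0
    have hc1 := conjLocal_frameEntry_mul_self_apply L v w hw t₀ P d ht₀ hP hd1 t 1
    have hv0' : Valued.v (((P⁻¹).val * ((t : ((cmDatum L 2 (Matrix.of fun i j : Fin 2 => if i.val + j.val + 1 = 2 then (1 : L) else 0)).Local v × (cmDatum L 1 (Matrix.of fun i j : Fin 1 => if i.val + j.val + 1 = 1 then (1 : L) else 0)).Local v)).1.val.val : Matrix (Fin 2) (Fin 2) (LocalRing L v)) * P.val) 0 0 w) = 1 := valued_apply_eq_one_of_conjLocal_mul_self L v w hw ha1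
    have hv1' : Valued.v (((P⁻¹).val * ((t : ((cmDatum L 2 (Matrix.of fun i j : Fin 2 => if i.val + j.val + 1 = 2 then (1 : L) else 0)).Local v × (cmDatum L 1 (Matrix.of fun i j : Fin 1 => if i.val + j.val + 1 = 1 then (1 : L) else 0)).Local v)).1.val.val : Matrix (Fin 2) (Fin 2) (LocalRing L v)) * P.val) 1 1 w) = 1 := valued_apply_eq_one_of_conjLocal_mul_self L v w hw hc1
    have hx1ne : ((P⁻¹).val * ((t : ((cmDatum L 2 (Matrix.of fun i j : Fin 2 => if i.val + j.val + 1 = 2 then (1 : L) else 0)).Local v × (cmDatum L 1 (Matrix.of fun i j : Fin 1 => if i.val + j.val + 1 = 1 then (1 : L) else 0)).Local v)).1.val.val : Matrix (Fin 2) (Fin 2) (LocalRing L v)) * P.val) 1 1 w ≠ 0 := fun h0 => by rw [h0, map_zero] at hv1'; exact zero_ne_one hv1'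
    have hne : ((P⁻¹).val * ((t : ((cmDatum L 2 (Matrix.of fun i j : Fin 2 => if i.val + j.val + 1 = 2 then (1 : L) else 0)).Local v × (cmDatum L 1 (Matrix.of fun i j : Fin 1 => if i.val + j.val + 1 = 1 then (1 : L) else 0)).Local v)).1.val.val : Matrix (Fin 2) (Fin 2) (LocalRing L v)) * P.val) 0 0 w ≠ ((P⁻¹).val * ((t : ((cmDatum L 2 (Matrix.of fun i j : Fin 2 => if i.val + j.val + 1 = 2 then (1 : L) else 0)).Local v × (cmDatum L 1 (Matrix.of fun i j : Fin 1 => if i.val + j.val + 1 = 1 then (1 : L) else 0)).Local v)).1.val.val : Matrix (Fin 2) (Fin 2) (LocalRing L v)) * P.val) 1 1 w := (localRing_ne_iff_apply_ne L v w hw _ _).1 ((isRegularElt_iff_frameEntry_ne L v w hw t₀ P d ht₀ hP hd1 t).1 hreg)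
    have hdiff : (((P⁻¹).val * ((t : ((cmDatum L 2 (Matrix.of fun i j : Fin 2 => if i.val + j.val + 1 = 2 then (1 : L) else 0)).Local v × (cmDatum L 1 (Matrix.of fun i j : Fin 1 => if i.val + j.val + 1 = 1 then (1 : L) else 0)).Local v)).1.val.val : Matrix (Fin 2) (Fin 2) (LocalRing L v)) * P.val) 0 0 - ((P⁻¹).val * ((t : ((cmDatum L 2 (Matrix.of fun i j : Fin 2 => if i.val + j.val + 1 = 2 then (1 : L) else 0)).Local v × (cmDatum L 1 (Matrix.of fun i j : Fin 1 => if i.val + j.val + 1 = 1 then (1 : L) else 0)).Local v)).1.val.val : Matrix (Fin 2) (Fin 2) (LocalRing L v)) * P.val) 1 1) w = ((P⁻¹).val * ((t : ((cmDatum L 2 (Matrix.of fun i j : Fin 2 => if i.val + j.val + 1 = 2 then (1 : L) else 0)).Local v × (cmDatum L 1 (Matrix.of fun i j : Fin 1 => if i.val + j.val + 1 = 1 then (1 : L) else 0)).Local v)).1.val.val : Matrix (Fin 2) (Fin 2) (LocalRing L v)) * P.val) 0 0 w - ((P⁻¹).val * ((t : ((cmDatum L 2 (Matrix.of fun i j :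 Fin 2 => if i.val + j.val + 1 = 2 then (1 : L) else 0)).Local v × (cmDatum L 1 (Matrix.of fun i j : Fin 1 => if i.val + j.val + 1 = 1 then (1 : L) else 0)).Local v)).1.val.val : Matrix (Fin 2) (Fin 2) (LocalRing L v)) * P.val) 1 1 w := Pi.sub_apply _ _ _
    have hd0 : ((P⁻¹).val * ((t : ((cmDatum L 2 (Matrix.of fun i j : Fin 2 => if i.val + j.val + 1 = 2 then (1 : L) else 0)).Local v × (cmDatum L 1 (Matrix.of fun i j : Fin 1 => if i.val + j.val + 1 = 1 then (1 : L) else 0)).Local v)).1.val.val : Matrix (Fin 2) (Fin 2) (LocalRing L v)) * P.val) 0 0 w - ((P⁻¹).val * ((t : ((cmDatum L 2 (Matrix.of fun i j : Fin 2 => if i.val + j.val + 1 = 2 then (1 : L) else 0)).Local v × (cmDatum L 1 (Matrix.of fun i j : Fin 1 => if i.val + j.val + 1 = 1 then (1 : L) else 0)).Local v)).1.val.val : Matrix (Fin 2) (Fin 2) (LocalRing L v)) * P.val) 1 1 w ≠ 0 := sub_ne_zero.2 hne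
    have hdle : Valued.v (((P⁻¹).val * ((t : ((cmDatum L 2 (Matrix.of fun i j : Fin 2 => if i.val + j.val + 1 = 2 then (1 : L) else 0)).Local v × (cmDatum L 1 (Matrix.of fun i j : Fin 1 => if i.val + j.val + 1 = 1 then (1 : L) else 0)).Local v)).1.val.val : Matrix (Fin 2) (Fin 2) (LocalRing L v)) * P.val) 0 0 w - ((P⁻¹).val * ((t : ((cmDatum L 2 (Matrix.of fun i j : Fin 2 => if i.val + j.val + 1 = 2 then (1 : L) else 0)).Local v × (cmDatum L 1 (Matrix.of fun i j : Fin 1 => if i.val + j.val + 1 = 1 then (1 : L) else 0)).Local v)).1.val.val : Matrix (Fin 2) (Fin 2) (LocalRing L v)) * P.val) 1 1 w) ≤ 1 := by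
      refine (Valuation.map_sub _ _ _).trans ?_; rw [hv0', hv1', max_self]
    obtain ⟨hs, hb⟩ := descent_scalars_ne_zero (toPlace v w) (hframe t) hDD hG hQu hne hx1ne
    obtain ⟨h10, hcases⟩ := frame_column_cases (toPlace v w) hsum hprod (hframe t) hDD hG hQu hDu hs hb
    -- deepness from `M ≤ N t`
    have hMt' : M ≤ (-WithZero.log (Valued.v (((P⁻¹).val * ((t : ((cmDatum L 2 (Matrix.of fun i j : Fin 2 => if i.val + j.val + 1 = 2 then (1 : L) else 0)).Local v × (cmDatum L 1 (Matrix.of fun i j : Fin 1 => if i.val + j.val + 1 = 1 then (1 : L) else 0)).Local v)).1.val.val : Matrix (Fin 2) (Fin 2) (LocalRing L v)) * P.val) 0 0 w - ((P⁻¹).val * ((t : ((cmDatum L 2 (Matrix.of fun i j : Fin 2 => if i.val + j.val + 1 = 2 then (1 : L) else 0)).Local v × (cmDatum L 1 (Matrix.of fun i j : Fin 1 => if i.val + j.val + 1 = 1 then (1 : L) else 0)).Local v)).1.val.val : Matrix (Fin 2) (Fin 2) (LocalRing L v)) * P.val) 1 1 w))).toNat := by rw [← hdiff]; exact hMt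
    have hlt₁ : Valued.v (((P⁻¹).val * ((t : ((cmDatum L 2 (Matrix.of fun i j : Fin 2 => if i.val + j.val + 1 = 2 then (1 : L) else 0)).Local v × (cmDatum L 1 (Matrix.of fun i j : Fin 1 => if i.val + j.val + 1 = 1 then (1 : L) else 0)).Local v)).1.val.val : Matrix (Fin 2) (Fin 2) (LocalRing L v)) * P.val) 0 0 w - ((P⁻¹).val * ((t : ((cmDatum L 2 (Matrix.of fun i j : Fin 2 => if i.val + j.val + 1 = 2 then (1 : L) else 0)).Local v × (cmDatum L 1 (Matrix.of fun i j : Fin 1 => if i.val + j.val + 1 = 1 then (1 : L) else 0)).Local v)).1.val.val : Matrix (Fin 2) (Fin 2) (LocalRing L v)) * P.val) 1 1 w) < Valued.v π₁ := valued_lt_of_toNat_succ_le hd0 hdle hπ₁0 (le_trans hM.2.2.1 hMt')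
    have hlt₂ : Valued.v (((P⁻¹).val * ((t : ((cmDatum L 2 (Matrix.of fun i j : Fin 2 => if i.val + j.val + 1 = 2 then (1 : L) else 0)).Local v × (cmDatum L 1 (Matrix.of fun i j : Fin 1 => if i.val + j.val + 1 = 1 then (1 : L) else 0)).Local v)).1.val.val : Matrix (Fin 2) (Fin 2) (LocalRing L v)) * P.val) 0 0 w - ((P⁻¹).val * ((t : ((cmDatum L 2 (Matrix.of fun i j : Fin 2 => if i.val + j.val + 1 = 2 then (1 : L) else 0)).Local v × (cmDatum L 1 (Matrix.of fun i j : Fin 1 => if i.val + j.val + 1 = 1 then (1 : L) else 0)).Local v)).1.val.val : Matrix (Fin 2) (Fin 2) (LocalRing L v)) * P.val) 1 1 w) < Valued.v π₂ := valued_lt_of_toNat_succ_le hd0 hdle hπ₂0 (le_trans hM.2.2.2.1 hMt')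
    have hlt₃ : Valued.v (((P⁻¹).val * ((t : ((cmDatum L 2 (Matrix.of fun i j : Fin 2 => if i.val + j.val + 1 = 2 then (1 : L) else 0)).Local v × (cmDatum L 1 (Matrix.of fun i j : Fin 1 => if i.val + j.val + 1 = 1 then (1 : L) else 0)).Local v)).1.val.val : Matrix (Fin 2) (Fin 2) (LocalRing L v)) * P.val) 0 0 w - ((P⁻¹).val * ((t : ((cmDatum L 2 (Matrix.of fun i j : Fin 2 => if i.val + j.val + 1 = 2 then (1 : L) else 0)).Local v × (cmDatum L 1 (Matrix.of fun i j : Fin 1 => if i.val + j.val + 1 = 1 then (1 : L) else 0)).Local v)).1.val.val : Matrix (Fin 2) (Fin 2) (LocalRing L v)) * P.val) 1 1 w) < Valued.v π₃ := valued_lt_of_toNat_succ_le hd0 hdle hπ₃0 (le_trans hM.2.2.2.2.1 hMt')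
    have hlt2 : Valued.v (((P⁻¹).val * ((t : ((cmDatum L 2 (Matrix.of fun i j : Fin 2 => if i.val + j.val + 1 = 2 then (1 : L) else 0)).Local v × (cmDatum L 1 (Matrix.of fun i j : Fin 1 => if i.val + j.val + 1 = 1 then (1 : L) else 0)).Local v)).1.val.val : Matrix (Fin 2) (Fin 2) (LocalRing L v)) * P.val) 0 0 w - ((P⁻¹).val * ((t : ((cmDatum L 2 (Matrix.of fun i j : Fin 2 => if i.val + j.val + 1 = 2 then (1 : L) else 0)).Local v × (cmDatum L 1 (Matrix.of fun i j : Fin 1 => if i.val + j.val + 1 = 1 then (1 : L) else 0)).Local v)).1.val.val : Matrix (Fin 2) (Fin 2) (LocalRing L v)) * P.val) 1 1 w) < Valued.v (2 : (w.1.adicCompletion L)) := valued_lt_of_toNat_succ_le hd0 hdle h2 (le_trans hM.2.2.2.2.2 hMt')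
    have hsmall₁ : Valued.v (((P⁻¹).val * ((t : ((cmDatum L 2 (Matrix.of fun i j : Fin 2 => if i.val + j.val + 1 = 2 then (1 : L) else 0)).Local v × (cmDatum L 1 (Matrix.of fun i j : Fin 1 => if i.val + j.val + 1 = 1 then (1 : L) else 0)).Local v)).1.val.val : Matrix (Fin 2) (Fin 2) (LocalRing L v)) * P.val) 0 0 w - ((P⁻¹).val * ((t : ((cmDatum L 2 (Matrix.of fun i j : Fin 2 => if i.val + j.val + 1 = 2 then (1 : L) else 0)).Local v × (cmDatum L 1 (Matrix.of fun i j : Fin 1 => if i.val + j.val + 1 = 1 then (1 : L) else 0)).Local v)).1.val.val : Matrix (Fin 2) (Fin 2) (LocalRing L v)) * P.val) 1 1 w) * Valued.v ((galAdicCompletionMap (L := L) (IsCMField.complexConj L) hw) τE) < Valued.v (τE - (galAdicCompletionMap (L := L) (IsCMField.complexConj L) hw) τE) := by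
      have h := mul_lt_mul_of_pos_right hlt₁ (show (0 : WithZero (Multiplicative ℤ)) < Valued.v ((galAdicCompletionMap (L := L) (IsCMField.complexConj L) hw) τE) from (Valuation.pos_iff _).2 hστ0)
      rwa [← Valuation.map_mul (Valued.v) π₁, hπ₁] at h
    have hsmall₂ : Valued.v (((P⁻¹).val * ((t : ((cmDatum L 2 (Matrix.of fun i j : Fin 2 => if i.val + j.val + 1 = 2 then (1 : L) else 0)).Local v × (cmDatum L 1 (Matrix.of fun i j : Fin 1 => if i.val + j.val + 1 = 1 then (1 : L) else 0)).Local v)).1.val.val : Matrix (Fin 2) (Fin 2) (LocalRing L v)) * P.val) 0 0 w - ((P⁻¹).val * ((t : ((cmDatum L 2 (Matrix.of fun i j : Fin 2 => if i.val + j.val + 1 = 2 then (1 : L) else 0)).Local v × (cmDatum L 1 (Matrix.of fun i j : Fin 1 => if i.val + j.val + 1 = 1 then (1 : L) else 0)).Local v)).1.val.val : Matrix (Fin 2) (Fin 2) (LocalRing L v)) * P.val) 1 1 w) * Valued.v ((toPlace v w) u₀) < Valued.v (8 : (w.1.adicCompletion L)) * Valued.v (τE - (galAdicCompletionMap (L :=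 L) (IsCMField.complexConj L) hw) τE) := by
      by_cases hu : u₀ = 0
      · rw [hu, map_zero, Valuation.map_zero, mul_zero]
        exact mul_pos (show (0 : WithZero (Multiplicative ℤ)) < Valued.v (8 : (w.1.adicCompletion L)) from (Valuation.pos_iff _).2 (by norm_num)) (show (0 : WithZero (Multiplicative ℤ)) < _ from (Valuation.pos_iff _).2 hτd0)
      · have hιu : (toPlace v w) u₀ ≠ 0 := (map_ne_zero (toPlace v w)).2 hu
        have h := mul_lt_mul_of_pos_right hlt₂ (show (0 : WithZero (Multiplicative ℤ)) < Valued.v ((toPlace v w) u₀) from (Valuation.pos_iff _).2 hιu)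
        rwa [← Valuation.map_mul (Valued.v) π₂, hπ₂ hu, Valuation.map_mul] at h
    -- `|(toPlace v w) bc| ≤ 1` (★ p844075 at `|x₀ − x₁| < |2|`, then `|x₀ − x₁| < |η∕2|`)
    have hbc1 : Valued.v (toPlace v w ((bc t : ((v.adicCompletion ↥(maximalRealSubfield L)))ˣ) : (v.adicCompletion ↥(maximalRealSubfield L)))) ≤ 1 := by
      have hv2 : Valued.v (2 : (w.1.adicCompletion L)) ≠ 0 := (Valuation.ne_zero_iff _).2 h2
      have hvη : Valued.v η ≠ 0 := (Valuation.ne_zero_iff _).2 hη0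
      rw [valued_toPlace_bcoord_eq L v w hw hη0 ha1 hc1 hlt2 hbct]
      have h' := mul_lt_mul_of_pos_right hlt₃ (show (0 : WithZero (Multiplicative ℤ)) < Valued.v (2 : (w.1.adicCompletion L)) from (Valuation.pos_iff _).2 h2)
      rw [← Valuation.map_mul (Valued.v) π₃, hπ₃] at h'
      have h'' := mul_lt_mul_of_pos_right h' (show (0 : WithZero (Multiplicative ℤ)) < (Valued.v η)⁻¹ from zero_lt_iff.2 (inv_ne_zero hvη))
      rw [mul_inv_cancel₀ hvη] at h''
      exact le_of_lt h''
    exact ⟨s, a, b, hG, h10, hcases, hv1', hne, hsmall₁, hsmall₂, hbc1, hNb, hmfl⟩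
  -- the `(galAdicCompletionMap (L := L) (IsCMField.complexConj L) hw)`-swapped smallness statements (label case (−))
  have hvv : Valued.v τE = Valued.v ((galAdicCompletionMap (L := L) (IsCMField.complexConj L) hw) τE) := by rw [valued_galAdicCompletionMap]
  have hswap₁ : ∀ {y : WithZero (Multiplicative ℤ)}, y * Valued.v ((galAdicCompletionMap (L := L) (IsCMField.complexConj L) hw) τE) < Valued.v (τE - (galAdicCompletionMap (L := L) (IsCMField.complexConj L) hw) τE) → y * Valued.v ((galAdicCompletionMap (L := L) (IsCMField.complexConj L) hw) ((galAdicCompletionMap (L := L) (IsCMField.complexConj L) hw) τE)) < Valued.v ((galAdicCompletionMap (L := L) (IsCMField.complexConj L) hw) τE - (galAdicCompletionMap (L := L) (IsCMField.complexConj L) hw) ((galAdicCompletionMap (L := L) (IsCMField.complexConj L) hw) τE)) := by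
    intro y hy; rwa [hσσ, show (galAdicCompletionMap (L := L) (IsCMField.complexConj L) hw) τE - τE = -(τE - (galAdicCompletionMap (L := L) (IsCMField.complexConj L) hw) τE) by ring, Valuation.map_neg, hvv]
  have hswap₂ : ∀ {y : WithZero (Multiplicative ℤ)}, y < Valued.v (8 : (w.1.adicCompletion L)) * Valued.v (τE - (galAdicCompletionMap (L := L) (IsCMField.complexConj L) hw) τE) → y < Valued.v (8 : (w.1.adicCompletion L)) * Valued.v ((galAdicCompletionMap (L := L) (IsCMField.complexConj L) hw) τE - (galAdicCompletionMap (L := L) (IsCMField.complexConj L) hw) ((galAdicCompletionMap (L := L) (IsCMField.complexConj L) hw) τE)) := by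
    intro y hy; rwa [hσσ, show (galAdicCompletionMap (L := L) (IsCMField.complexConj L) hw) τE - τE = -(τE - (galAdicCompletionMap (L := L) (IsCMField.complexConj L) hw) τE) by ring, Valuation.map_neg]
  -- the label case, decided once by the fixed frame
  by_cases hcase : (Matrix.diagonal ![1, α] * (Pw : Matrix (Fin 2) (Fin 2) (w.1.adicCompletion L))) 0 0 = -((galAdicCompletionMap (L := L) (IsCMField.complexConj L) hw) τE) * (Matrix.diagonal ![1, α] * (Pw : Matrix (Fin 2) (Fin 2) (w.1.adicCompletion L))) 1 0
  · refine ⟨M, -WithZero.log (Valued.v ((2 : (v.adicCompletion ↥(maximalRealSubfield L))) * c')), Units.mk0 (2 * c') h2c'0, fun t ht hMt => ?_⟩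
    obtain ⟨s, a, b, hG, h10, -, hv1', hne, hsmall₁, hsmall₂, hbc1, -, hmfl⟩ := hper t ht hMt
    obtain ⟨βF₀, hβF₀, hβv⟩ := hβspec t ht hmfl
    have hbct := hbc t ht (hper t ht hMt).choose_spec.choose_spec.choose_spec.2.2.2.2.2.2.2.2.1
    obtain ⟨-, -, hdict, -⟩ := depth_and_sign_of_descent_frame L v w hw hsum hprod hτne hη0 hα0 (hframe t) hQu hG hcase h10 hv1' hne hsmall₁ hsmall₂ hbct hβF₀ hc'
    have hexp := valued_toPlace_bcoord_eq_exp L v w hw he h2c'0 hdict hβv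
    refine ⟨hexp, add_nonneg_of_valued_toPlace_eq_exp_le_one L v w hexp hbc1, fun βF hβF => ?_⟩
    obtain ⟨-, -, -, hsign⟩ := depth_and_sign_of_descent_frame L v w hw hsum hprod hτne hη0 hα0 (hframe t) hQu hG hcase h10 hv1' hne hsmall₁ hsmall₂ hbct hβF hc'
    rw [Units.val_mul, Units.val_mk0]
    exact hsign
  · have h2neg : (2 : (v.adicCompletion ↥(maximalRealSubfield L))) * -c' ≠ 0 := mul_ne_zero two_ne_zero (neg_ne_zero.2 hc'0)
    refine ⟨M, -WithZero.log (Valued.v ((2 : (v.adicCompletion ↥(maximalRealSubfield L))) * -c')), Units.mk0 (2 * -c') h2neg, fun t ht hMt => ?_⟩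
    obtain ⟨s, a, b, hG, h10, hcases, hv1', hne, hsmall₁, hsmall₂, hbc1, -, hmfl⟩ := hper t ht hMt
    obtain ⟨βF₀, hβF₀, hβv⟩ := hβspec t ht hmfl
    have hbct := hbc t ht (hper t ht hMt).choose_spec.choose_spec.choose_spec.2.2.2.2.2.2.2.2.1
    have hcase' : (Matrix.diagonal ![1, α] * (Pw : Matrix (Fin 2) (Fin 2) (w.1.adicCompletion L))) 0 0 = -((galAdicCompletionMap (L := L) (IsCMField.complexConj L) hw) ((galAdicCompletionMap (L := L) (IsCMField.complexConj L) hw) τE)) * (Matrix.diagonal ![1, α] * (Pw : Matrix (Fin 2) (Fin 2) (w.1.adicCompletion L))) 1 0 := by rw [hσσ]; exact hcases.resolve_left hcase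
    obtain ⟨-, -, hdict, -⟩ := depth_and_sign_of_descent_frame L v w hw hsum' hprod' hτne' hη0 hα0 (hframe t) hQu hG hcase' h10 hv1' hne (hswap₁ hsmall₁) (hswap₂ hsmall₂) hbct hβF₀ hc''
    have hexp := valued_toPlace_bcoord_eq_exp L v w hw he h2neg hdict hβv
    refine ⟨hexp, add_nonneg_of_valued_toPlace_eq_exp_le_one L v w hexp hbc1, fun βF hβF => ?_⟩
    obtain ⟨-, -, -, hsign⟩ := depth_and_sign_of_descent_frame L v w hw hsum' hprod' hτne' hη0 hα0 (hframe t) hQu hG hcase' h10 hv1' hne (hswap₁ hsmall₁) (hswap₂ hsmall₂) hbct hβF hc''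
    rw [Units.val_mul, Units.val_mk0]
    exact hsign

-- `L_w`-sized statement and a long composition: elaboration budget only (no search)
set_option maxHeartbeats 1600000 in
/-- **THE FOLD's `(hoT, hκT, hnn)` LITERALLY**, for a (B6-V) sign of the shape `κT t = ((βF·n_t, θ)_v : ℂ)` with `(n_t, θ)_v = 1`, `n_t ≠ 0` (B-p14 (g33): `n_t = c^(−oT t)`,
`c = N(ηE)` a norm — ★ `hilbertSymbol_eq_one_of_toPlace_eq_mul_galAdicCompletionMap`): `∃ M k₁ c₀, ∀ t ∈ U, M ≤ N t → |ι ↑(bc t)| = exp(−(2·oT t + 2·k₁)) ∧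
κT t = ((↑(bc t·c₀), θ)_v : ℂ) ∧ 0 ≤ oT t + k₁` — feed `k₀ := 2·k₁` to ★ `exists_wildLaw_torus_of_shellLaws_of_le` and `k₁` to ★ `exists_wildLaw_of_fold`.
[cite: LabesseLanglands1979, §2 (2.1)–(2.2)] [cite: Labesse2024StabilisationGermesSL2, Th. 0.0.12] [cite: Omeara1963, §63B] -/
theorem exists_depth_sign_dictionary_torus_of_norm
    (bc : ↥(Subgroup.centralizer ({t₀} : Set ((cmDatum L 2 (Matrix.of fun i j : Fin 2 => if i.val + j.val + 1 = 2 then (1 : L) else 0)).Local v × (cmDatum L 1 (Matrix.of fun i j : Fin 1 => if i.val + j.val + 1 = 1 then (1 : L) else 0)).Local v))) → ((v.adicCompletion ↥(maximalRealSubfield L)))ˣ) (Nb : ℕ)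
    (hbc : ∀ t : ↥(Subgroup.centralizer ({t₀} : Set ((cmDatum L 2 (Matrix.of fun i j : Fin 2 => if i.val + j.val + 1 = 2 then (1 : L) else 0)).Local v × (cmDatum L 1 (Matrix.of fun i j : Fin 1 => if i.val + j.val + 1 = 1 then (1 : L) else 0)).Local v))), t ∈ {t : ↥(Subgroup.centralizer ({t₀} : Set ((cmDatum L 2 (Matrix.of fun i j : Fin 2 => if i.val + j.val + 1 = 2 then (1 : L) else 0)).Local v × (cmDatum L 1 (Matrix.of fun i j : Fin 1 => if i.val + j.val + 1 = 1 then (1 : L) else 0)).Local v))) | IsRegularElt ((t : ((cmDatum L 2 (Matrix.of fun i j : Fin 2 => if i.val + j.val + 1 = 2 then (1 : L) else 0)).Local v × (cmDatum L 1 (Matrix.of fun i j : Fin 1 => if i.val + j.val + 1 = 1 then (1 : L) else 0)).Local v)).1.val : GL (Fin 2) (LocalRing L v))} → Nb ≤ (-WithZero.log (Valued.v ((((P⁻¹).val * ((t : ((cmDatum L 2 (Matrix.of fun i j : Fin 2 => if i.val + j.val + 1 = 2 then (1 : L) else 0)).Local v × (cmDatum L 1 (Matrix.of fun i j : Fin 1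 => if i.val + j.val + 1 = 1 then (1 : L) else 0)).Local v)).1.val.val : Matrix (Fin 2) (Fin 2) (LocalRing L v)) * P.val) 0 0 - ((P⁻¹).val * ((t : ((cmDatum L 2 (Matrix.of fun i j : Fin 2 => if i.val + j.val + 1 = 2 then (1 : L) else 0)).Local v × (cmDatum L 1 (Matrix.of fun i j : Fin 1 => if i.val + j.val + 1 = 1 then (1 : L) else 0)).Local v)).1.val.val : Matrix (Fin 2) (Fin 2) (LocalRing L v)) * P.val) 1 1) w))).toNat →
      toPlace v w ((bc t : ((v.adicCompletion ↥(maximalRealSubfield L)))ˣ) : (v.adicCompletion ↥(maximalRealSubfield L))) = (((P⁻¹).val * ((t : ((cmDatum L 2 (Matrix.of fun i j : Fin 2 => if i.val + j.val + 1 = 2 then (1 : L) else 0)).Local v × (cmDatum L 1 (Matrix.of fun i j : Fin 1 => if i.val + j.val + 1 = 1 then (1 : L) else 0)).Local v)).1.val.val : Matrix (Fin 2) (Fin 2) (LocalRing L v)) * P.val) 0 0 w / ((P⁻¹).val * ((t : ((cmDatum L 2 (Matrix.of fun i j : Fin 2 => if i.val + j.val + 1 = 2 then (1 : L) else 0)).Local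 v × (cmDatum L 1 (Matrix.of fun i j : Fin 1 => if i.val + j.val + 1 = 1 then (1 : L) else 0)).Local v)).1.val.val : Matrix (Fin 2) (Fin 2) (LocalRing L v)) * P.val) 1 1 w - ((P⁻¹).val * ((t : ((cmDatum L 2 (Matrix.of fun i j : Fin 2 => if i.val + j.val + 1 = 2 then (1 : L) else 0)).Local v × (cmDatum L 1 (Matrix.of fun i j : Fin 1 => if i.val + j.val + 1 = 1 then (1 : L) else 0)).Local v)).1.val.val : Matrix (Fin 2) (Fin 2) (LocalRing L v)) * P.val) 1 1 w / ((P⁻¹).val * ((t : ((cmDatum L 2 (Matrix.of fun i j : Fin 2 => if i.val + j.val + 1 = 2 then (1 : L) else 0)).Local v × (cmDatum L 1 (Matrix.of fun i j : Fin 1 => if i.val + j.val + 1 = 1 then (1 : L) else 0)).Local v)).1.val.val : Matrix (Fin 2) (Fin 2) (LocalRing L v)) * P.val) 0 0 w) / η)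
    (mfl : ℕ) (oT : ↥(Subgroup.centralizer ({t₀} : Set ((cmDatum L 2 (Matrix.of fun i j : Fin 2 => if i.val + j.val + 1 = 2 then (1 : L) else 0)).Local v × (cmDatum L 1 (Matrix.of fun i j : Fin 1 => if i.val + j.val + 1 = 1 then (1 : L) else 0)).Local v))) → ℕ) (κT : ↥(Subgroup.centralizer ({t₀} : Set ((cmDatum L 2 (Matrix.of fun i j : Fin 2 => if i.val + j.val + 1 = 2 then (1 : L) else 0)).Local v × (cmDatum L 1 (Matrix.of fun i j : Fin 1 => if i.val + j.val + 1 = 1 then (1 : L) else 0)).Local v))) → ℂ) (nf : ↥(Subgroup.centralizer ({t₀} : Set ((cmDatum L 2 (Matrix.of fun i j : Fin 2 => if i.val + j.val + 1 = 2 then (1 : L) else 0)).Local v × (cmDatum L 1 (Matrix.of fun i j : Fin 1 => if i.val + j.val + 1 = 1 then (1 : L) else 0)).Local v))) → (v.adicCompletion ↥(maximalRealSubfield L)))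
    (hnf : ∀ t : ↥(Subgroup.centralizer ({t₀} : Set ((cmDatum L 2 (Matrix.of fun i j : Fin 2 => if i.val + j.val + 1 = 2 then (1 : L) else 0)).Local v × (cmDatum L 1 (Matrix.of fun i j : Fin 1 => if i.val + j.val + 1 = 1 then (1 : L) else 0)).Local v))), t ∈ {t : ↥(Subgroup.centralizer ({t₀} : Set ((cmDatum L 2 (Matrix.of fun i j : Fin 2 => if i.val + j.val + 1 = 2 then (1 : L) else 0)).Local v × (cmDatum L 1 (Matrix.of fun i j : Fin 1 => if i.val + j.val + 1 = 1 then (1 : L) else 0)).Local v))) | IsRegularElt ((t : ((cmDatum L 2 (Matrix.of fun i j : Fin 2 => if i.val + j.val + 1 = 2 then (1 : L) else 0)).Local v × (cmDatum L 1 (Matrix.of fun i j : Fin 1 => if i.val + j.val + 1 = 1 then (1 : L) else 0)).Local v)).1.val : GL (Fin 2) (LocalRing L v))} → mfl ≤ (-WithZero.log (Valued.v ((((P⁻¹).val * ((t : ((cmDatum L 2 (Matrix.of fun i j : Fin 2 => if i.val + j.val + 1 = 2 then (1 : L) else 0)).Local v × (cmDatum L 1 (Matrix.of fun i j : Fin 1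 => if i.val + j.val + 1 = 1 then (1 : L) else 0)).Local v)).1.val.val : Matrix (Fin 2) (Fin 2) (LocalRing L v)) * P.val) 0 0 - ((P⁻¹).val * ((t : ((cmDatum L 2 (Matrix.of fun i j : Fin 2 => if i.val + j.val + 1 = 2 then (1 : L) else 0)).Local v × (cmDatum L 1 (Matrix.of fun i j : Fin 1 => if i.val + j.val + 1 = 1 then (1 : L) else 0)).Local v)).1.val.val : Matrix (Fin 2) (Fin 2) (LocalRing L v)) * P.val) 1 1) w))).toNat → nf t ≠ 0 ∧ hilbertSymbol (v.adicCompletion ↥(maximalRealSubfield L)) (nf t) (algebraMap ↥(maximalRealSubfield L) _ ((cmQuadraticGenerator L : 𝓞 ↥(maximalRealSubfield L)) : ↥(maximalRealSubfield L))) = 1)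
    (hspec : ∀ t : ↥(Subgroup.centralizer ({t₀} : Set ((cmDatum L 2 (Matrix.of fun i j : Fin 2 => if i.val + j.val + 1 = 2 then (1 : L) else 0)).Local v × (cmDatum L 1 (Matrix.of fun i j : Fin 1 => if i.val + j.val + 1 = 1 then (1 : L) else 0)).Local v))), t ∈ {t : ↥(Subgroup.centralizer ({t₀} : Set ((cmDatum L 2 (Matrix.of fun i j : Fin 2 => if i.val + j.val + 1 = 2 then (1 : L) else 0)).Local v × (cmDatum L 1 (Matrix.of fun i j : Fin 1 => if i.val + j.val + 1 = 1 then (1 : L) else 0)).Local v))) | IsRegularElt ((t : ((cmDatum L 2 (Matrix.of fun i j : Fin 2 => if i.val + j.val + 1 = 2 then (1 : L) else 0)).Local v × (cmDatum L 1 (Matrix.of fun i j : Fin 1 => if i.val + j.val + 1 = 1 then (1 : L) else 0)).Local v)).1.val : GL (Fin 2) (LocalRing L v))} → mfl ≤ (-WithZero.log (Valued.v ((((P⁻¹).val * ((t : ((cmDatum L 2 (Matrix.of fun i j : Fin 2 => if i.val + j.val + 1 = 2 then (1 : L) else 0)).Local v × (cmDatum L 1 (Matrix.of fun i j : Fin 1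 => if i.val + j.val + 1 = 1 then (1 : L) else 0)).Local v)).1.val.val : Matrix (Fin 2) (Fin 2) (LocalRing L v)) * P.val) 0 0 - ((P⁻¹).val * ((t : ((cmDatum L 2 (Matrix.of fun i j : Fin 2 => if i.val + j.val + 1 = 2 then (1 : L) else 0)).Local v × (cmDatum L 1 (Matrix.of fun i j : Fin 1 => if i.val + j.val + 1 = 1 then (1 : L) else 0)).Local v)).1.val.val : Matrix (Fin 2) (Fin 2) (LocalRing L v)) * P.val) 1 1) w))).toNat →
      ∃ βF : (v.adicCompletion ↥(maximalRealSubfield L)), toPlace v w βF = α * ((((E₂ (t : ((cmDatum L 2 (Matrix.of fun i j : Fin 2 => if i.val + j.val + 1 = 2 then (1 : L) else 0)).Local v × (cmDatum L 1 (Matrix.of fun i j : Fin 1 => if i.val + j.val + 1 = 1 then (1 : L) else 0)).Local v)).1 : ↥(unitaryGroupOfForm (galAdicCompletionMap (L := L) (IsCMField.complexConj L) hw) (placeForm (Matrix.of fun i j : Fin 2 => if i.val + j.val + 1 = 2 then (1 : L) else 0) w.1))) : GL (Fin 2) (w.1.adicCompletion L)) : Matrix (Fin 2) (Fin 2) (w.1.adicCompletion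 L))) 1 0 / ((((E₂ (t : ((cmDatum L 2 (Matrix.of fun i j : Fin 2 => if i.val + j.val + 1 = 2 then (1 : L) else 0)).Local v × (cmDatum L 1 (Matrix.of fun i j : Fin 1 => if i.val + j.val + 1 = 1 then (1 : L) else 0)).Local v)).1 : ↥(unitaryGroupOfForm (galAdicCompletionMap (L := L) (IsCMField.complexConj L) hw) (placeForm (Matrix.of fun i j : Fin 2 => if i.val + j.val + 1 = 2 then (1 : L) else 0) w.1))) : GL (Fin 2) (w.1.adicCompletion L)) : Matrix (Fin 2) (Fin 2) (w.1.adicCompletion L))) 0 0 ∧ Valued.v βF = WithZero.exp (-(oT t : ℤ)) ∧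
        κT t = ((hilbertSymbol (v.adicCompletion ↥(maximalRealSubfield L)) (βF * nf t) (algebraMap ↥(maximalRealSubfield L) _ ((cmQuadraticGenerator L : 𝓞 ↥(maximalRealSubfield L)) : ↥(maximalRealSubfield L))) : ℤ) : ℂ)) :
    ∃ (M : ℕ) (k₁ : ℤ) (c₀ : ((v.adicCompletion ↥(maximalRealSubfield L)))ˣ), ∀ t : ↥(Subgroup.centralizer ({t₀} : Set ((cmDatum L 2 (Matrix.of fun i j : Fin 2 => if i.val + j.val + 1 = 2 then (1 : L) else 0)).Local v × (cmDatum L 1 (Matrix.of fun i j : Fin 1 => if i.val + j.val + 1 = 1 then (1 : L) else 0)).Local v))), t ∈ {t : ↥(Subgroup.centralizer ({t₀} : Set ((cmDatum L 2 (Matrix.of fun i j : Fin 2 => if i.val + j.val + 1 = 2 then (1 : L) else 0)).Local v × (cmDatum L 1 (Matrix.of fun i j : Fin 1 => if i.val + j.val + 1 = 1 then (1 : L) else 0)).Local v))) | IsRegularElt ((t : ((cmDatum L 2 (Matrix.of fun i j : Fin 2 => if i.val + j.val + 1 = 2 then (1 : L) else 0)).Local v × (cmDatum L 1 (Matrix.of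 fun i j : Fin 1 => if i.val + j.val + 1 = 1 then (1 : L) else 0)).Local v)).1.val : GL (Fin 2) (LocalRing L v))} → M ≤ (-WithZero.log (Valued.v ((((P⁻¹).val * ((t : ((cmDatum L 2 (Matrix.of fun i j : Fin 2 => if i.val + j.val + 1 = 2 then (1 : L) else 0)).Local v × (cmDatum L 1 (Matrix.of fun i j : Fin 1 => if i.val + j.val + 1 = 1 then (1 : L) else 0)).Local v)).1.val.val : Matrix (Fin 2) (Fin 2) (LocalRing L v)) * P.val) 0 0 - ((P⁻¹).val * ((t : ((cmDatum L 2 (Matrix.of fun i j : Fin 2 => if i.val + j.val + 1 = 2 then (1 : L) else 0)).Local v × (cmDatum L 1 (Matrix.of fun i j : Fin 1 => if i.val + j.val + 1 = 1 then (1 : L) else 0)).Local v)).1.val.val : Matrix (Fin 2) (Fin 2) (LocalRing L v)) * P.val) 1 1) w))).toNat →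
      Valued.v (toPlace v w ((bc t : ((v.adicCompletion ↥(maximalRealSubfield L)))ˣ) : (v.adicCompletion ↥(maximalRealSubfield L)))) = WithZero.exp (-(2 * (oT t : ℤ) + 2 * k₁)) ∧
      κT t = ((hilbertSymbol (v.adicCompletion ↥(maximalRealSubfield L)) (((bc t * c₀ : ((v.adicCompletion ↥(maximalRealSubfield L)))ˣ)) : (v.adicCompletion ↥(maximalRealSubfield L))) (algebraMap ↥(maximalRealSubfield L) _ ((cmQuadraticGenerator L : 𝓞 ↥(maximalRealSubfield L)) : ↥(maximalRealSubfield L))) : ℤ) : ℂ) ∧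
      0 ≤ (oT t : ℤ) + k₁ := by
  have hθ0 : (algebraMap ↥(maximalRealSubfield L) _ ((cmQuadraticGenerator L : 𝓞 ↥(maximalRealSubfield L)) : ↥(maximalRealSubfield L)) : (v.adicCompletion ↥(maximalRealSubfield L))) ≠ 0 := by
    rw [Ne, map_eq_zero_iff _ (algebraMap ↥(maximalRealSubfield L) (v.adicCompletion ↥(maximalRealSubfield L))).injective]
    exact fun h => not_isSquare_cmQuadraticGenerator L (by rw [h]; exact IsSquare.zero)
  obtain ⟨M, k₁, c₀, hM⟩ := exists_depth_sign_dictionary_torus L v w hw he t₀ P d ht₀ hP hd1 E₂ hE₂ hα hα0 hv0 hτ hστ hτne hση hη0 hpos bc Nb hbc mfl oT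
    (fun t ht hm => by obtain ⟨βF, h1, h2, -⟩ := hspec t ht hm; exact ⟨βF, h1, h2⟩)
  refine ⟨max M mfl, k₁, c₀, fun t ht hMt => ?_⟩
  obtain ⟨hoT, hnn, hsign⟩ := hM t ht (le_trans (le_max_left _ _) hMt)
  have hm : mfl ≤ (-WithZero.log (Valued.v ((((P⁻¹).val * ((t : ((cmDatum L 2 (Matrix.of fun i j : Fin 2 => if i.val + j.val + 1 = 2 then (1 : L) else 0)).Local v × (cmDatum L 1 (Matrix.of fun i j : Fin 1 => if i.val + j.val + 1 = 1 then (1 : L) else 0)).Local v)).1.val.val : Matrix (Fin 2) (Fin 2) (LocalRing L v)) * P.val) 0 0 - ((P⁻¹).val * ((t : ((cmDatum L 2 (Matrix.of fun i j : Fin 2 => if i.val + j.val + 1 = 2 then (1 : L) else 0)).Local v × (cmDatum L 1 (Matrix.of fun i j : Fin 1 => if i.val + j.val + 1 = 1 then (1 : L) else 0)).Local v)).1.val.val : Matrix (Fin 2) (Fin 2) (LocalRing L v)) * P.val) 1 1) w))).toNat := le_trans (le_max_right _ _) hMt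
  obtain ⟨βF, hβF, -, hκ⟩ := hspec t ht hm
  obtain ⟨hn0, hn1⟩ := hnf t ht hm
  refine ⟨hoT, ?_, hnn⟩
  -- `βF ≠ 0`: its symbol with the unit `bc t·c₀` would otherwise read `(0, θ)`; we avoid this by the multiplicativity route only when `βF ≠ 0`
  by_cases hβ0 : βF = 0
  · -- degenerate reading: `ι βF = 0` forces `X₁₀ = 0`, but then the sign law is read with `βF = 0` on both sides consistently
    rw [hκ, hβ0, zero_mul, hsign βF hβF, hβ0]
  · rw [hκ, hilbertSymbol_adicCompletion_mul_left ↥(maximalRealSubfield L) v hβ0 hn0 hθ0, hn1, mul_one, hsign βF hβF]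

-- `L_w`-sized statement: elaboration budget only (no search)
set_option maxHeartbeats 1600000 in
/-- **(ED. 2) THE FOLD's `(hoT, hκT, hnn)` LITERALLY for the (B6-V) HEAD's design of record** (B-p14 (g33) HANDOFF 30fdf257 §3, holder p08 (g16)): `κT t := ((b t, θ)_v : ℂ)` with
`ι (b t) = α·T₁₀∕T₀₀`, `|b t|_v = exp(−oT t)` — i.e. the (B6-V) → (B6-O) interface `SPEC mfl oT κT` of the CLOSE (F0P3-p01 (g15) v4) reads
`∀ t ∈ U, mfl ≤ N t → ∃ βF, ι βF = α·X₁₀∕X₀₀ ∧ |βF|_v = exp(−oT t) ∧ κT t = ((βF, θ)_v : ℂ)`; then `hOt := exists_depth_sign_dictionary_torus_of_symbol`.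
[cite: LabesseLanglands1979, §2 (2.1)–(2.2)] [cite: Labesse2024StabilisationGermesSL2, Th. 0.0.12] -/
theorem exists_depth_sign_dictionary_torus_of_symbol
    (bc : ↥(Subgroup.centralizer ({t₀} : Set ((cmDatum L 2 (Matrix.of fun i j : Fin 2 => if i.val + j.val + 1 = 2 then (1 : L) else 0)).Local v × (cmDatum L 1 (Matrix.of fun i j : Fin 1 => if i.val + j.val + 1 = 1 then (1 : L) else 0)).Local v))) → ((v.adicCompletion ↥(maximalRealSubfield L)))ˣ) (Nb : ℕ)
    (hbc : ∀ t : ↥(Subgroup.centralizer ({t₀} : Set ((cmDatum L 2 (Matrix.of fun i j : Fin 2 => if i.val + j.val + 1 = 2 then (1 : L) else 0)).Local v × (cmDatum L 1 (Matrix.of fun i j : Fin 1 => if i.val + j.val + 1 = 1 then (1 : L) else 0)).Local v))), t ∈ {t : ↥(Subgroup.centralizer ({t₀} : Set ((cmDatum L 2 (Matrix.of fun i j : Fin 2 => if i.val + j.val + 1 = 2 then (1 : L) else 0)).Local v × (cmDatum L 1 (Matrix.of fun i j : Fin 1 => if i.val + j.val + 1 = 1 then (1 : L) else 0)).Local v)))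 | IsRegularElt ((t : ((cmDatum L 2 (Matrix.of fun i j : Fin 2 => if i.val + j.val + 1 = 2 then (1 : L) else 0)).Local v × (cmDatum L 1 (Matrix.of fun i j : Fin 1 => if i.val + j.val + 1 = 1 then (1 : L) else 0)).Local v)).1.val : GL (Fin 2) (LocalRing L v))} → Nb ≤ (-WithZero.log (Valued.v ((((P⁻¹).val * ((t : ((cmDatum L 2 (Matrix.of fun i j : Fin 2 => if i.val + j.val + 1 = 2 then (1 : L) else 0)).Local v × (cmDatum L 1 (Matrix.of fun i j : Fin 1 => if i.val + j.val + 1 = 1 then (1 : L) else 0)).Local v)).1.val.val : Matrix (Fin 2) (Fin 2) (LocalRing L v)) * P.val) 0 0 - ((P⁻¹).val * ((t : ((cmDatum L 2 (Matrix.of fun i j : Fin 2 => if i.val + j.val + 1 = 2 then (1 : L) else 0)).Local v × (cmDatum L 1 (Matrix.of fun i j : Fin 1 => if i.val + j.val + 1 = 1 then (1 : L) else 0)).Local v)).1.val.val : Matrix (Fin 2) (Fin 2) (LocalRing L v)) * P.val) 1 1) w))).toNat →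
      toPlace v w ((bc t : ((v.adicCompletion ↥(maximalRealSubfield L)))ˣ) : (v.adicCompletion ↥(maximalRealSubfield L))) = (((P⁻¹).val * ((t : ((cmDatum L 2 (Matrix.of fun i j : Fin 2 => if i.val + j.val + 1 = 2 then (1 : L) else 0)).Local v × (cmDatum L 1 (Matrix.of fun i j : Fin 1 => if i.val + j.val + 1 = 1 then (1 : L) else 0)).Local v)).1.val.val : Matrix (Fin 2) (Fin 2) (LocalRing L v)) * P.val) 0 0 w / ((P⁻¹).val * ((t : ((cmDatum L 2 (Matrix.of fun i j : Fin 2 => if i.val + j.val + 1 = 2 then (1 : L) else 0)).Local v × (cmDatum L 1 (Matrix.of fun i j : Fin 1 => if i.val + j.val + 1 = 1 then (1 : L) else 0)).Local v)).1.val.val : Matrix (Fin 2) (Fin 2) (LocalRing L v)) * P.val) 1 1 w - ((P⁻¹).val * ((t : ((cmDatum L 2 (Matrix.of fun i j : Fin 2 => if i.val + j.val + 1 = 2 then (1 : L) else 0)).Local v × (cmDatum L 1 (Matrix.of fun i j : Fin 1 => if i.val + j.val + 1 = 1 then (1 : L) else 0)).Local v)).1.val.val : Matrix (Fin 2) (Fin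 2) (LocalRing L v)) * P.val) 1 1 w / ((P⁻¹).val * ((t : ((cmDatum L 2 (Matrix.of fun i j : Fin 2 => if i.val + j.val + 1 = 2 then (1 : L) else 0)).Local v × (cmDatum L 1 (Matrix.of fun i j : Fin 1 => if i.val + j.val + 1 = 1 then (1 : L) else 0)).Local v)).1.val.val : Matrix (Fin 2) (Fin 2) (LocalRing L v)) * P.val) 0 0 w) / η)
    (mfl : ℕ) (oT : ↥(Subgroup.centralizer ({t₀} : Set ((cmDatum L 2 (Matrix.of fun i j : Fin 2 => if i.val + j.val + 1 = 2 then (1 : L) else 0)).Local v × (cmDatum L 1 (Matrix.of fun i j : Fin 1 => if i.val + j.val + 1 = 1 then (1 : L) else 0)).Local v))) → ℕ) (κT : ↥(Subgroup.centralizer ({t₀} : Set ((cmDatum L 2 (Matrix.of fun i j : Fin 2 => if i.val + j.val + 1 = 2 then (1 : L) else 0)).Local v × (cmDatum L 1 (Matrix.of fun i j : Fin 1 => if i.val + j.val + 1 = 1 then (1 : L) else 0)).Local v))) → ℂ)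
    (hspec : ∀ t : ↥(Subgroup.centralizer ({t₀} : Set ((cmDatum L 2 (Matrix.of fun i j : Fin 2 => if i.val + j.val + 1 = 2 then (1 : L) else 0)).Local v × (cmDatum L 1 (Matrix.of fun i j : Fin 1 => if i.val + j.val + 1 = 1 then (1 : L) else 0)).Local v))), t ∈ {t : ↥(Subgroup.centralizer ({t₀} : Set ((cmDatum L 2 (Matrix.of fun i j : Fin 2 => if i.val + j.val + 1 = 2 then (1 : L) else 0)).Local v × (cmDatum L 1 (Matrix.of fun i j : Fin 1 => if i.val + j.val + 1 = 1 then (1 : L) else 0)).Local v))) | IsRegularElt ((t : ((cmDatum L 2 (Matrix.of fun i j : Fin 2 => if i.val + j.val + 1 = 2 then (1 : L) else 0)).Local v × (cmDatum L 1 (Matrix.of fun i j : Fin 1 => if i.val + j.val + 1 = 1 then (1 : L) else 0)).Local v)).1.val : GL (Fin 2) (LocalRing L v))} → mfl ≤ (-WithZero.log (Valued.v ((((P⁻¹).val * ((t : ((cmDatum L 2 (Matrix.of fun i j : Fin 2 => if i.val + j.val + 1 = 2 then (1 : L) else 0)).Local v × (cmDatum L 1 (Matrix.of fun i j : Fin 1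 => if i.val + j.val + 1 = 1 then (1 : L) else 0)).Local v)).1.val.val : Matrix (Fin 2) (Fin 2) (LocalRing L v)) * P.val) 0 0 - ((P⁻¹).val * ((t : ((cmDatum L 2 (Matrix.of fun i j : Fin 2 => if i.val + j.val + 1 = 2 then (1 : L) else 0)).Local v × (cmDatum L 1 (Matrix.of fun i j : Fin 1 => if i.val + j.val + 1 = 1 then (1 : L) else 0)).Local v)).1.val.val : Matrix (Fin 2) (Fin 2) (LocalRing L v)) * P.val) 1 1) w))).toNat →
      ∃ βF : (v.adicCompletion ↥(maximalRealSubfield L)), toPlace v w βF = α * ((((E₂ (t : ((cmDatum L 2 (Matrix.of fun i j : Fin 2 => if i.val + j.val + 1 = 2 then (1 : L) else 0)).Local v × (cmDatum L 1 (Matrix.of fun i j : Fin 1 => if i.val + j.val + 1 = 1 then (1 : L) else 0)).Local v)).1 : ↥(unitaryGroupOfForm (galAdicCompletionMap (L := L) (IsCMField.complexConj L) hw) (placeForm (Matrix.of fun i j : Fin 2 => if i.val + j.val + 1 = 2 then (1 : L) else 0) w.1))) : GL (Fin 2) (w.1.adicCompletion L)) : Matrix (Fin 2) (Fin 2) (w.1.adicCompletion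 L))) 1 0 / ((((E₂ (t : ((cmDatum L 2 (Matrix.of fun i j : Fin 2 => if i.val + j.val + 1 = 2 then (1 : L) else 0)).Local v × (cmDatum L 1 (Matrix.of fun i j : Fin 1 => if i.val + j.val + 1 = 1 then (1 : L) else 0)).Local v)).1 : ↥(unitaryGroupOfForm (galAdicCompletionMap (L := L) (IsCMField.complexConj L) hw) (placeForm (Matrix.of fun i j : Fin 2 => if i.val + j.val + 1 = 2 then (1 : L) else 0) w.1))) : GL (Fin 2) (w.1.adicCompletion L)) : Matrix (Fin 2) (Fin 2) (w.1.adicCompletion L))) 0 0 ∧ Valued.v βF = WithZero.exp (-(oT t : ℤ)) ∧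
        κT t = ((hilbertSymbol (v.adicCompletion ↥(maximalRealSubfield L)) βF (algebraMap ↥(maximalRealSubfield L) _ ((cmQuadraticGenerator L : 𝓞 ↥(maximalRealSubfield L)) : ↥(maximalRealSubfield L))) : ℤ) : ℂ)) :
    ∃ (M : ℕ) (k₁ : ℤ) (c₀ : ((v.adicCompletion ↥(maximalRealSubfield L)))ˣ), ∀ t : ↥(Subgroup.centralizer ({t₀} : Set ((cmDatum L 2 (Matrix.of fun i j : Fin 2 => if i.val + j.val + 1 = 2 then (1 : L) else 0)).Local v × (cmDatum L 1 (Matrix.of fun i j : Fin 1 => if i.val + j.val + 1 = 1 then (1 : L) else 0)).Local v))), t ∈ {t : ↥(Subgroup.centralizer ({t₀} : Set ((cmDatum L 2 (Matrix.of fun i j : Fin 2 => if i.val + j.val + 1 = 2 then (1 : L) else 0)).Local v × (cmDatum L 1 (Matrix.of fun i j : Fin 1 => if i.val + j.val + 1 = 1 then (1 : L) else 0)).Local v))) | IsRegularElt ((t : ((cmDatum L 2 (Matrix.of fun i j : Fin 2 => if i.val + j.val + 1 = 2 then (1 : L) else 0)).Local v × (cmDatum L 1 (Matrix.of fun i j :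 Fin 1 => if i.val + j.val + 1 = 1 then (1 : L) else 0)).Local v)).1.val : GL (Fin 2) (LocalRing L v))} → M ≤ (-WithZero.log (Valued.v ((((P⁻¹).val * ((t : ((cmDatum L 2 (Matrix.of fun i j : Fin 2 => if i.val + j.val + 1 = 2 then (1 : L) else 0)).Local v × (cmDatum L 1 (Matrix.of fun i j : Fin 1 => if i.val + j.val + 1 = 1 then (1 : L) else 0)).Local v)).1.val.val : Matrix (Fin 2) (Fin 2) (LocalRing L v)) * P.val) 0 0 - ((P⁻¹).val * ((t : ((cmDatum L 2 (Matrix.of fun i j : Fin 2 => if i.val + j.val + 1 = 2 then (1 : L) else 0)).Local v × (cmDatum L 1 (Matrix.of fun i j : Fin 1 => if i.val + j.val + 1 = 1 then (1 : L) else 0)).Local v)).1.val.val : Matrix (Fin 2) (Fin 2) (LocalRing L v)) * P.val) 1 1) w))).toNat →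
      Valued.v (toPlace v w ((bc t : ((v.adicCompletion ↥(maximalRealSubfield L)))ˣ) : (v.adicCompletion ↥(maximalRealSubfield L)))) = WithZero.exp (-(2 * (oT t : ℤ) + 2 * k₁)) ∧
      κT t = ((hilbertSymbol (v.adicCompletion ↥(maximalRealSubfield L)) (((bc t * c₀ : ((v.adicCompletion ↥(maximalRealSubfield L)))ˣ)) : (v.adicCompletion ↥(maximalRealSubfield L))) (algebraMap ↥(maximalRealSubfield L) _ ((cmQuadraticGenerator L : 𝓞 ↥(maximalRealSubfield L)) : ↥(maximalRealSubfield L))) : ℤ) : ℂ) ∧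
      0 ≤ (oT t : ℤ) + k₁ :=
  exists_depth_sign_dictionary_torus_of_norm L v w hw he t₀ P d ht₀ hP hd1 E₂ hE₂ hα hα0 hv0 hτ hστ hτne hση hη0 hpos bc Nb hbc mfl oT κT (fun _ => 1)
    (fun _ _ _ => ⟨one_ne_zero, hilbertSymbol_one_left _⟩)
    (fun t ht hm => by obtain ⟨βF, h1, h2, h3⟩ := hspec t ht hm; exact ⟨βF, h1, h2, by rw [mul_one]; exact h3⟩)

end Torus

end Literature.NumberTheory.Rogawski1990

end
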